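import Literature.NumberTheory.Sieve.MaynardNFYm
import Literature.NumberTheory.Sieve.MaynardNFS2Weights
import Literature.NumberTheory.Sieve.MaynardNFSmooth
import Literature.NumberTheory.Sieve.MaynardNFMainTermC
import Literature.NumberTheory.Sieve.MaynardNFDiagonal
import Literature.NumberTheory.Sieve.MaynardTaoLargeKProofs
import Literature.NumberTheory.Sieve.MaynardSieveLemma63Sum
import HarnessLib

/-!
# The Maynard–Tao sieve over `𝓞_K`: the main term of `S₂^{(m)}` (Maynard's Lemma 6.3 over `𝓞_K`)

Topic `Literature/NumberTheory/Sieve`. A. Castillo, C. Hall, R. J. Lemke Oliver, P. Pollack,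
L. Thompson, *Bounded gaps between primes in number fields and function fields*, Proc. AMS 143 (2015)
= arXiv:1403.5808, proof of Proposition 2.1, `S₂` part ("exactly the same reasoning as Maynard's
proofs of Lemmas 6.1 and 6.3"): with the smooth choice `y = F(log N𝔯ᵢ/log R)` (`F = 1_{R_k} G`),
`∑_𝔲 (y^{(m)}_𝔲)²/∏ g(𝔲ᵢ) = (c_K (φ(𝔴)/N𝔴) log R)^{k+1} (J_k^{(m)}(F) + o(1))`.
Route (all PROVED here; it avoids the pointwise evaluation of `y^{(m)}`): by Lemma 2.4
(`MaynardNFYm.abs_ym_sub_main_le`) `y^{(m)}_𝔲 = κ(𝔲) M(𝔲) + (small)`, `M(𝔲) = ∑_𝔞 y_{𝔲[m↦𝔞]}/φ(𝔞)`;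
expanding `M(𝔲)²` turns `∑_𝔲 κ(𝔲)²M(𝔲)²/∏g(𝔲ᵢ)` into a `(k+1)`-fold sum over
`(𝔲₁,…,𝔞,…,𝔲_k; 𝔟)` with the one-dimensional weights `w₃ = κ₁²/g` (slots `i ≠ m`) and `1/φ`
(slots `𝔞, 𝔟`) and the function `F(x)F(x[m↦t])`; dropping the cross-coprimality conditions costs
`O(D₀^{-1/2})` relatively (`MaynardNFS2Weights.sum_prod_bad_pairs_le`), and the coordinatewise sum
is evaluated by `MaynardNFMainTermC.abs_sum_piFinset_G1_sub_integral_le_C` in dimension `k + 1`;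
finally `∫_{[0,1]^{k+1}} F(x)F(x[m↦t]) = J_k^{(m)}(F)` (Fubini).

## References

* Castillo–Hall–Lemke Oliver–Pollack–Thompson, arXiv:1403.5808, Lemma 2.4 and proof of
  Proposition 2.1. [CastilloEtAl2015]
* J. Maynard, *Small gaps between primes*, Ann. of Math. 181 (2015), Lemmas 5.3, 6.3.
  [MaynardAnnals2015]
-/

noncomputable section

open Finset Filter Topology Asymptotics UniqueFactorizationMonoid NumberField MeasureTheory
  IsDedekindDomain
open scoped NumberField Classical

namespace Literature.NumberTheory.Sieve.MaynardNF

open Literature.NumberTheory.LFunctions Literature.NumberTheory.LFunctions.NumberField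
  Literature.NumberTheory.Sieve.MaynardTao Literature.NumberTheory.Sieve.IdealSieve

variable {K : Type*} [Field K] [NumberField K]
variable {k : ℕ}

/-! ### Notation for `(k+1)`-tuples -/

/-- The first `k` coordinates of a `(k+1)`-tuple. [folklore] -/
def zcs (z : Fin (k + 1) → Ideal (𝓞 K)) : Fin k → Ideal (𝓞 K) := fun i => z (Fin.castSucc i)

/-- The first `k` coordinates with slot `m` replaced by the last coordinate. [folklore] -/
def zup (m : Fin k) (z : Fin (k + 1) → Ideal (𝓞 K)) : Fin k → Ideal (𝓞 K) :=
  Function.update (zcs z) m (z (Fin.last k))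

omit [NumberField K] in
/-- `zcs (snoc 𝔲 𝔟) = 𝔲`. [folklore] -/
theorem zcs_snoc (𝔲 : Fin k → Ideal (𝓞 K)) (𝔟 : Ideal (𝓞 K)) :
    zcs (Fin.snoc (α := fun _ => Ideal (𝓞 K)) 𝔲 𝔟) = 𝔲 := by
  funext i; simp [zcs]

omit [NumberField K] in
/-- `snoc (zcs z) (z last) = z`. [folklore] -/
theorem snoc_zcs (z : Fin (k + 1) → Ideal (𝓞 K)) :
    Fin.snoc (α := fun _ => Ideal (𝓞 K)) (zcs z) (z (Fin.last k)) = z := by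
  funext j
  rcases Fin.eq_castSucc_or_eq_last j with ⟨i, rfl⟩ | rfl
  · simp [zcs]
  · simp

/-! ### `w₃` and the product of Lemma 2.4's `κ` -/

/-- `w₃((1)) = 1`. [folklore] -/
theorem w3_top : w3 K ⊤ = 1 := by
  rw [w3, gId_top, idealTotient_top, Ideal.absNorm_top]; simp

/-- `κ(𝔲)²/∏ g(𝔲ᵢ) = ∏ w₃(𝔲ᵢ)` for good `𝔲` (the primes of norm `2` dividing `𝔴`). [folklore] -/
theorem kappa_sq_div_prod_gId {𝔴 : Ideal (𝓞 K)} {B : ℝ}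
    (h2 : ∀ P : Ideal (𝓞 K), Prime P → Ideal.absNorm P = 2 → P ∣ 𝔴)
    {𝔲 : Fin k → Ideal (𝓞 K)} (hu : ∀ i, 𝔲 i ∈ G1 K 𝔴 B) :
    kappa K 𝔲 ^ 2 / ∏ i, gId K (𝔲 i) = ∏ i, w3 K (𝔲 i) := by
  rw [kappa, ← Finset.prod_pow, ← Finset.prod_div_distrib]
  refine Finset.prod_congr rfl fun i _ => ?_
  have hg := gId_pos_of_mem_G1 h2 (hu i)
  have hφ := idealTotient_pos_of_mem_G1 (hu i)
  rw [w3]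
  field_simp

/-! ### Step A: from `y^{(m)}` to `κ(𝔲) M(𝔲)` -/

section StepA

variable {𝔴 : Ideal (𝓞 K)} {B : ℝ} {y : (Fin k → Ideal (𝓞 K)) → ℝ} {m : Fin k}

/-- If `𝔲[m ↦ 𝔞]` is a good tuple of the box and `𝔲_m = (1)`, then so is `𝔲` (`B ≥ 1`). [folklore] -/
theorem mem_boxG_of_update_mem {𝔲 : Fin k → Ideal (𝓞 K)} (hum : 𝔲 m = ⊤) {𝔞 : Ideal (𝓞 K)}
    (h : Function.update 𝔲 m 𝔞 ∈ boxG K k 𝔴 B) : 𝔲 ∈ boxG K k 𝔴 B := by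
  have hB : 1 ≤ B := by
    have := (mem_box_iff.1 (mem_boxG.1 h).1 m).2
    have h1 : (1 : ℝ) ≤ Ideal.absNorm (Function.update 𝔲 m 𝔞 m) := by
      exact_mod_cast Nat.one_le_iff_ne_zero.2 (by
        rw [Ne, Ideal.absNorm_eq_zero_iff]; exact (mem_box_iff.1 (mem_boxG.1 h).1 m).1)
    exact h1.trans this
  have hdvd : ∀ i, 𝔲 i ∣ Function.update 𝔲 m 𝔞 i := fun i => by
    by_cases hi : i = m
    · subst hi; rw [hum, ← Ideal.one_eq_top]; exact one_dvd _
    · rw [Function.update_of_ne hi]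
  refine mem_boxG.2 ⟨mem_box_iff.2 fun i => ?_, (mem_boxG.1 h).2.of_dvd hdvd⟩
  by_cases hi : i = m
  · subst hi; rw [hum]; exact ⟨top_ne_bot, by rw [Ideal.absNorm_top, Nat.cast_one]; exact hB⟩
  · have := mem_box_iff.1 (mem_boxG.1 h).1 i
    rwa [Function.update_of_ne hi] at this

/-- `M(𝔲) = 0` off the good tuples (for `y` supported on good tuples, `𝔲_m = (1)`). [folklore] -/
theorem Mterm_eq_zero_of_not_mem (hy : SupportedOn K k 𝔴 B y) {𝔲 : Fin k → Ideal (𝓞 K)} (hum : 𝔲 m = ⊤)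
    (hu : 𝔲 ∉ boxG K k 𝔴 B) : Mterm K B y m 𝔲 = 0 := by
  refine Finset.sum_eq_zero fun 𝔞 _ => ?_
  have : y (Function.update 𝔲 m 𝔞) = 0 := by
    by_contra h
    exact hu (mem_boxG_of_update_mem hum (mem_boxG.2 ⟨(hy _ h).1, (hy _ h).2⟩))
  rw [this, zero_div]

/-- The `𝔲` with `𝔲_m = (1)` in the coordinatewise box: a product box. [folklore] -/
theorem filter_piFinset_slot_eq (hB : 1 ≤ B) (m : Fin k) :
    (Fintype.piFinset fun _ : Fin k => G1 K 𝔴 B).filter (fun 𝔲 => 𝔲 m = ⊤) =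
      Fintype.piFinset fun i => if i = m then ({⊤} : Finset (Ideal (𝓞 K))) else G1 K 𝔴 B := by
  ext 𝔲
  simp only [Finset.mem_filter, Fintype.mem_piFinset]
  constructor
  · rintro ⟨h, hm⟩ i
    by_cases hi : i = m
    · subst hi; simp [hm]
    · rw [if_neg hi]; exact h i
  · intro h
    have hm : 𝔲 m = ⊤ := by have := h m; simpa using this
    refine ⟨fun i => ?_, hm⟩
    by_cases hi : i = m
    · subst hi; rw [hm]; exact top_mem_G1 hB
    · have := h i; rwa [if_neg hi] at this

/-- `∑_{𝔲 ∈ G1^k, 𝔲_m = (1)} ∏ w₃(𝔲ᵢ) = L₃^{k−1}`, `L₃ = ∑_{G1} w₃`. [folklore] -/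
theorem sum_filter_slot_prod_w3_eq (hB : 1 ≤ B) (m : Fin k) :
    ∑ 𝔲 ∈ (Fintype.piFinset fun _ : Fin k => G1 K 𝔴 B).filter (fun 𝔲 => 𝔲 m = ⊤), ∏ i, w3 K (𝔲 i) =
      (∑ 𝔞 ∈ G1 K 𝔴 B, w3 K 𝔞) ^ (k - 1) := by
  rw [filter_piFinset_slot_eq hB m, ← Finset.prod_univ_sum (fun i => if i = m then ({⊤} : Finset (Ideal (𝓞 K)))
    else G1 K 𝔴 B) (fun _ 𝔞 => w3 K 𝔞), ← Finset.mul_prod_erase _ _ (Finset.mem_univ m), if_pos rfl,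
    Finset.sum_singleton, w3_top, one_mul]
  rw [Finset.prod_congr rfl fun i hi => by rw [if_neg (Finset.mem_erase.1 hi).1], Finset.prod_const,
    Finset.card_erase_of_mem (Finset.mem_univ m), Finset.card_univ, Fintype.card_fin]

/-- **Step A**: when the primes of norm `2` divide `𝔴`, `y` is supported on good tuples with
`|y| ≤ y_max`, and `E₀ = y_max k L (Z−1) Z^k` is the error of Lemma 2.4,
`|∑_{𝔲 good} (y^{(m)}_𝔲)²/∏g(𝔲ᵢ) − ∑_{𝔲 ∈ G1^k, 𝔲_m=(1)} (∏ w₃(𝔲ᵢ)) M(𝔲)²| ≤ (2 y_max L E₀ + E₀²) L₃^{k−1}`.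
[cite: CastilloEtAl2015, Lemma 2.4; MaynardAnnals2015, proof of Lemma 6.3] -/
theorem abs_sum_ym_sq_div_sub_le (h2 : ∀ P : Ideal (𝓞 K), Prime P → Ideal.absNorm P = 2 → P ∣ 𝔴)
    (hB : 1 ≤ B) (hy : SupportedOn K k 𝔴 B y) {ymax : ℝ} (hymax : ∀ 𝔯, |y 𝔯| ≤ ymax) :
    |∑ 𝔲 ∈ boxG K k 𝔴 B, ym K k 𝔴 B y m 𝔲 ^ 2 / ∏ i, gId K (𝔲 i) -
        ∑ 𝔲 ∈ (Fintype.piFinset fun _ : Fin k => G1 K 𝔴 B).filter (fun 𝔲 => 𝔲 m = ⊤),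
          (∏ i, w3 K (𝔲 i)) * Mterm K B y m 𝔲 ^ 2| ≤
      (2 * ymax * (∑ 𝔫 ∈ G1 K 𝔴 B, 1 / idealTotient K 𝔫) *
          (ymax * ((k : ℝ) * ((∑ 𝔫 ∈ G1 K 𝔴 B, 1 / idealTotient K 𝔫) *
            ((∑ 𝔫 ∈ G1 K 𝔴 B, 1 / idealTotient K 𝔫 ^ 2 - 1) *
              (∑ 𝔫 ∈ G1 K 𝔴 B, 1 / idealTotient K 𝔫 ^ 2) ^ k)))) +
        (ymax * ((k : ℝ) * ((∑ 𝔫 ∈ G1 K 𝔴 B, 1 / idealTotient K 𝔫) *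
            ((∑ 𝔫 ∈ G1 K 𝔴 B, 1 / idealTotient K 𝔫 ^ 2 - 1) *
              (∑ 𝔫 ∈ G1 K 𝔴 B, 1 / idealTotient K 𝔫 ^ 2) ^ k)))) ^ 2) *
        (∑ 𝔞 ∈ G1 K 𝔴 B, w3 K 𝔞) ^ (k - 1) := by
  classical
  obtain ⟨L, hL⟩ : ∃ x : ℝ, x = ∑ 𝔫 ∈ G1 K 𝔴 B, 1 / idealTotient K 𝔫 := ⟨_, rfl⟩
  obtain ⟨E₀, hE₀⟩ : ∃ x : ℝ, x = ymax * ((k : ℝ) * (L *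
      ((∑ 𝔫 ∈ G1 K 𝔴 B, 1 / idealTotient K 𝔫 ^ 2 - 1) *
        (∑ 𝔫 ∈ G1 K 𝔴 B, 1 / idealTotient K 𝔫 ^ 2) ^ k))) := ⟨_, rfl⟩
  rw [← hL, ← hE₀]
  have hy0 : 0 ≤ ymax := le_trans (abs_nonneg _) (hymax fun _ => ⊥)
  have hpos : ∀ 𝔫 ∈ G1 K 𝔴 B, 0 < idealTotient K 𝔫 := fun 𝔫 hn => idealTotient_pos_of_mem_G1 hn
  have hL0 : 0 ≤ L := by rw [hL]; exact Finset.sum_nonneg fun 𝔫 hn => (one_div_pos.2 (hpos 𝔫 hn)).le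
  have hZ1 : 1 ≤ ∑ 𝔫 ∈ G1 K 𝔴 B, 1 / idealTotient K 𝔫 ^ 2 := by
    have := Finset.single_le_sum (f := fun 𝔫 : Ideal (𝓞 K) => 1 / idealTotient K 𝔫 ^ 2)
      (fun 𝔫 hn => by have := hpos 𝔫 hn; positivity) (top_mem_G1 hB)
    rwa [idealTotient_top, one_pow, div_one] at this
  have hE₀0 : 0 ≤ E₀ := by
    rw [hE₀]
    exact mul_nonneg hy0 (mul_nonneg (Nat.cast_nonneg _) (mul_nonneg hL0
      (mul_nonneg (by linarith) (by positivity))))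
  have hw0 : ∀ 𝔞 ∈ G1 K 𝔴 B, 0 ≤ w3 K 𝔞 := fun 𝔞 ha => w3_nonneg_of_mem_G1 h2 ha
  -- restrict the first sum to `𝔲_m = (1)`, written over the coordinatewise box
  have hfirst : ∑ 𝔲 ∈ boxG K k 𝔴 B, ym K k 𝔴 B y m 𝔲 ^ 2 / ∏ i, gId K (𝔲 i) =
      ∑ 𝔲 ∈ (Fintype.piFinset fun _ : Fin k => G1 K 𝔴 B).filter (fun 𝔲 => 𝔲 m = ⊤),
        (if 𝔲 ∈ boxG K k 𝔴 B then ym K k 𝔴 B y m 𝔲 ^ 2 / ∏ i, gId K (𝔲 i) else 0) := by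
    have hset : ((Fintype.piFinset fun _ : Fin k => G1 K 𝔴 B).filter (fun 𝔲 => 𝔲 m = ⊤)).filter
        (fun 𝔲 => 𝔲 ∈ boxG K k 𝔴 B) = (boxG K k 𝔴 B).filter (fun 𝔲 => 𝔲 m = ⊤) := by
      ext 𝔲
      simp only [Finset.mem_filter, Fintype.mem_piFinset]
      constructor
      · rintro ⟨⟨-, hm⟩, hb⟩; exact ⟨hb, hm⟩
      · rintro ⟨hb, hm⟩; exact ⟨⟨fun i => apply_mem_G1_of_mem_boxG hb i, hm⟩, hb⟩
    rw [← Finset.sum_filter, hset, Finset.sum_filter]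
    refine Finset.sum_congr rfl fun 𝔲 _ => ?_
    split_ifs with hm
    · rfl
    · rw [ym_eq_zero_of_ne hm]; simp
  rw [hfirst, ← Finset.sum_sub_distrib]
  -- termwise
  have hterm : ∀ 𝔲 ∈ (Fintype.piFinset fun _ : Fin k => G1 K 𝔴 B).filter (fun 𝔲 => 𝔲 m = ⊤),
      |(if 𝔲 ∈ boxG K k 𝔴 B then ym K k 𝔴 B y m 𝔲 ^ 2 / ∏ i, gId K (𝔲 i) else 0) -
          (∏ i, w3 K (𝔲 i)) * Mterm K B y m 𝔲 ^ 2| ≤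
        (2 * ymax * L * E₀ + E₀ ^ 2) * ∏ i, w3 K (𝔲 i) := by
    intro 𝔲 hu
    rw [Finset.mem_filter] at hu
    obtain ⟨huG', hum⟩ := hu
    have huG : ∀ i, 𝔲 i ∈ G1 K 𝔴 B := fun i => Fintype.mem_piFinset.1 huG' i
    have hW0 : 0 ≤ ∏ i, w3 K (𝔲 i) := Finset.prod_nonneg fun i _ => hw0 _ (huG i)
    by_cases hbox : 𝔲 ∈ boxG K k 𝔴 B
    · rw [if_pos hbox]
      have hκ := kappa_pos h2 hbox
      have hg : 0 < ∏ i, gId K (𝔲 i) := Finset.prod_pos fun i _ => gId_pos_of_mem_G1 h2 (huG i)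
      have hwg : (∏ i, w3 K (𝔲 i)) * ∏ i, gId K (𝔲 i) = kappa K 𝔲 ^ 2 := by
        rw [← kappa_sq_div_prod_gId h2 huG, div_mul_cancel₀ _ hg.ne']
      have h53 := abs_ym_sub_main_le h2 hy hymax hbox hum (m := m)
      rw [← hL] at h53
      have hM := abs_Mterm_le hy hymax 𝔲 (m := m) (K := K)
      rw [← hL] at hM
      obtain ⟨e, he⟩ : ∃ e : ℝ, e = ym K k 𝔴 B y m 𝔲 - kappa K 𝔲 * Mterm K B y m 𝔲 := ⟨_, rfl⟩
      have heb : |e| ≤ kappa K 𝔲 * E₀ := by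
        rw [he, hE₀]; refine h53.trans (le_of_eq ?_); ring
      have hym : ym K k 𝔴 B y m 𝔲 = kappa K 𝔲 * Mterm K B y m 𝔲 + e := by rw [he]; ring
      rw [hym]
      have hdiff : (kappa K 𝔲 * Mterm K B y m 𝔲 + e) ^ 2 / ∏ i, gId K (𝔲 i) -
          (∏ i, w3 K (𝔲 i)) * Mterm K B y m 𝔲 ^ 2 =
          e * (2 * kappa K 𝔲 * Mterm K B y m 𝔲 + e) / ∏ i, gId K (𝔲 i) := by
        rw [← kappa_sq_div_prod_gId h2 huG]
        field_simp
        ring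
      rw [hdiff, abs_div, abs_of_pos hg, abs_mul, div_le_iff₀ hg]
      have hMe : |2 * kappa K 𝔲 * Mterm K B y m 𝔲 + e| ≤ kappa K 𝔲 * (2 * ymax * L + E₀) := by
        calc |2 * kappa K 𝔲 * Mterm K B y m 𝔲 + e| ≤ |2 * kappa K 𝔲 * Mterm K B y m 𝔲| + |e| :=
              abs_add_le _ _
          _ ≤ 2 * kappa K 𝔲 * (ymax * L) + kappa K 𝔲 * E₀ := by
              rw [abs_mul, abs_of_pos (by positivity : 0 < 2 * kappa K 𝔲)]
              exact add_le_add (mul_le_mul_of_nonneg_left hM (by positivity)) heb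
          _ = kappa K 𝔲 * (2 * ymax * L + E₀) := by ring
      calc |e| * |2 * kappa K 𝔲 * Mterm K B y m 𝔲 + e| ≤
            (kappa K 𝔲 * E₀) * (kappa K 𝔲 * (2 * ymax * L + E₀)) :=
            mul_le_mul heb hMe (abs_nonneg _) (by positivity)
        _ = (2 * ymax * L * E₀ + E₀ ^ 2) * ((∏ i, w3 K (𝔲 i)) * ∏ i, gId K (𝔲 i)) := by
            rw [hwg]; ring
        _ = _ := by ring
    · rw [if_neg hbox, Mterm_eq_zero_of_not_mem hy hum hbox]
      simp only [zero_pow two_ne_zero, mul_zero, sub_zero, abs_zero]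
      positivity
  refine (Finset.abs_sum_le_sum_abs _ _).trans ((Finset.sum_le_sum hterm).trans (le_of_eq ?_))
  rw [← Finset.mul_sum, sum_filter_slot_prod_w3_eq hB m]

end StepA

/-! ### Step B: expanding `M(𝔲)²` — a `(k+1)`-fold sum -/

section StepB

variable {𝔴 : Ideal (𝓞 K)} {B : ℝ} {y : (Fin k → Ideal (𝓞 K)) → ℝ} {m : Fin k}

/-- `M(𝔲)` as a sum over `G1` (for `y` supported on good tuples). [folklore] -/
theorem Mterm_eq_sum_G1 (hy : SupportedOn K k 𝔴 B y) (𝔲 : Fin k → Ideal (𝓞 K)) :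
    Mterm K B y m 𝔲 = ∑ 𝔞 ∈ G1 K 𝔴 B, y (Function.update 𝔲 m 𝔞) / idealTotient K 𝔞 := by
  rw [Mterm]
  symm
  refine Finset.sum_subset (fun 𝔞 ha => (Finset.mem_filter.1 ha).1) fun 𝔞 _ hna => ?_
  have : y (Function.update 𝔲 m 𝔞) = 0 := by
    by_contra h
    have := apply_mem_G1_of_mem_boxG (mem_boxG.2 ⟨(hy _ h).1, (hy _ h).2⟩) m
    simp at this
    exact hna this
  rw [this, zero_div]

/-- **Step B**: `∑_{𝔲 ∈ G1^k, 𝔲_m=(1)} (∏ w₃(𝔲ᵢ)) M(𝔲)²` is the `(k+1)`-fold sum over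
`z = (𝔲₁,…,𝔞,…,𝔲_k; 𝔟) ∈ G1^{k+1}` of `(∏_{i≠m} w₃(zᵢ)) (y_{z'}/φ(𝔞)) (y_{z'[m↦𝔟]}/φ(𝔟))`
(`z'` the first `k` coordinates). [cite: MaynardAnnals2015, proof of Lemma 6.3 (squaring out)] -/
theorem sum_filter_slot_Mterm_sq_eq (hB : 1 ≤ B) (hy : SupportedOn K k 𝔴 B y) :
    ∑ 𝔲 ∈ (Fintype.piFinset fun _ : Fin k => G1 K 𝔴 B).filter (fun 𝔲 => 𝔲 m = ⊤),
        (∏ i, w3 K (𝔲 i)) * Mterm K B y m 𝔲 ^ 2 =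
      ∑ z ∈ Fintype.piFinset (fun _ : Fin (k + 1) => G1 K 𝔴 B),
        (∏ i ∈ Finset.univ.erase m, w3 K (z (Fin.castSucc i))) *
          ((y (zcs z) / idealTotient K (z (Fin.castSucc m))) *
            (y (zup m z) / idealTotient K (z (Fin.last k)))) := by
  classical
  -- the left side as a sum over the product finset
  set T := ((Fintype.piFinset fun _ : Fin k => G1 K 𝔴 B).filter (fun 𝔲 => 𝔲 m = ⊤)) ×ˢ
    (G1 K 𝔴 B ×ˢ G1 K 𝔴 B) with hT
  set f : (Fin k → Ideal (𝓞 K)) × (Ideal (𝓞 K) × Ideal (𝓞 K)) → ℝ := fun p =>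
    (∏ i ∈ Finset.univ.erase m, w3 K (p.1 i)) *
      ((y (Function.update p.1 m p.2.1) / idealTotient K p.2.1) *
        (y (Function.update p.1 m p.2.2) / idealTotient K p.2.2)) with hf
  have hLHS : ∑ 𝔲 ∈ (Fintype.piFinset fun _ : Fin k => G1 K 𝔴 B).filter (fun 𝔲 => 𝔲 m = ⊤),
      (∏ i, w3 K (𝔲 i)) * Mterm K B y m 𝔲 ^ 2 = ∑ p ∈ T, f p := by
    rw [hT, Finset.sum_product]
    refine Finset.sum_congr rfl fun 𝔲 hu => ?_
    have hum : 𝔲 m = ⊤ := (Finset.mem_filter.1 hu).2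
    have hprod : ∏ i, w3 K (𝔲 i) = ∏ i ∈ Finset.univ.erase m, w3 K (𝔲 i) := by
      rw [← Finset.mul_prod_erase _ _ (Finset.mem_univ m), hum, w3_top, one_mul]
    rw [hprod, Mterm_eq_sum_G1 hy, sq, Finset.sum_mul_sum, Finset.mul_sum, Finset.sum_product]
    refine Finset.sum_congr rfl fun 𝔞 _ => ?_
    rw [Finset.mul_sum]
  rw [hLHS]
  -- the bijection
  refine Finset.sum_nbij' (fun p => Fin.snoc (α := fun _ => Ideal (𝓞 K)) (Function.update p.1 m p.2.1) p.2.2)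
    (fun z => (Function.update (zcs z) m ⊤, (z (Fin.castSucc m), z (Fin.last k)))) ?_ ?_ ?_ ?_ ?_
  · -- into `G1^{k+1}`
    intro p hp
    rw [hT, Finset.mem_product, Finset.mem_product, Finset.mem_filter, Fintype.mem_piFinset] at hp
    obtain ⟨⟨hu, hum⟩, ha, hb⟩ := hp
    rw [Fintype.mem_piFinset]
    intro j
    rcases Fin.eq_castSucc_or_eq_last j with ⟨i, rfl⟩ | rfl
    · rw [Fin.snoc_castSucc]
      by_cases hi : i = m
      · rw [hi, Function.update_self]; exact ha
      · rw [Function.update_of_ne hi]; exact hu i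
    · rw [Fin.snoc_last]; exact hb
  · -- back into `T`
    intro z hz
    rw [Fintype.mem_piFinset] at hz
    rw [hT, Finset.mem_product, Finset.mem_product, Finset.mem_filter, Fintype.mem_piFinset]
    refine ⟨⟨fun i => ?_, by simp⟩, hz _, hz _⟩
    show Function.update (zcs z) m ⊤ i ∈ G1 K 𝔴 B
    by_cases hi : i = m
    · rw [hi, Function.update_self]; exact top_mem_G1 hB
    · rw [Function.update_of_ne hi]; exact hz _
  · -- left inverse
    intro p hp
    rw [hT, Finset.mem_product, Finset.mem_filter] at hp
    have hum : p.1 m = ⊤ := hp.1.2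
    refine Prod.ext ?_ (Prod.ext ?_ ?_)
    · simp only [zcs_snoc, Function.update_idem]
      conv_rhs => rw [← Function.update_eq_self m p.1]
      rw [hum]
    · simp only [Fin.snoc_castSucc, Function.update_self]
    · simp only [Fin.snoc_last]
  · -- right inverse
    intro z _
    simp only [Function.update_idem]
    have : Function.update (zcs z) m (z (Fin.castSucc m)) = zcs z := Function.update_eq_self m (zcs z)
    rw [this, snoc_zcs]
  · -- the summands agree
    intro p hp
    rw [hT, Finset.mem_product, Finset.mem_filter] at hp
    simp only [hf, zcs_snoc, zup, Fin.snoc_castSucc, Fin.snoc_last, Function.update_self,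
      Function.update_idem]
    congr 1
    refine Finset.prod_congr rfl fun i hi => ?_
    rw [Function.update_of_ne (Finset.mem_erase.1 hi).1]

end StepB

/-! ### Step C: dropping the cross-coprimality conditions -/

section StepC

variable {𝔴 : Ideal (𝓞 K)} {B : ℝ} {m : Fin k}

/-- The vector of logarithms `(log N𝔯ᵢ/log R)ᵢ`. [folklore] -/
def xOf (R : ℝ) (𝔯 : Fin k → Ideal (𝓞 K)) : Fin k → ℝ := fun i => Real.log (Ideal.absNorm (𝔯 i)) / Real.log R

/-- The one-dimensional weights of the `(k+1)`-fold sum: `1/φ` at the two slot-`m` coordinates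
(`castSucc m` and `last`), `w₃` elsewhere. [folklore] -/
def wtj (m : Fin k) (j : Fin (k + 1)) (𝔞 : Ideal (𝓞 K)) : ℝ :=
  if j = Fin.castSucc m ∨ j = Fin.last k then 1 / idealTotient K 𝔞 else w3 K 𝔞

/-- The admissible pairs: all off-diagonal pairs of coordinates except `{castSucc m, last}` (the two
slot-`m` variables need not be coprime to each other). [folklore] -/
def reqPairs (k : ℕ) (m : Fin k) : Finset (Fin (k + 1) × Fin (k + 1)) :=
  Finset.univ.filter fun q => q.1 ≠ q.2 ∧ ¬(q.1 = Fin.castSucc m ∧ q.2 = Fin.last k) ∧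
    ¬(q.1 = Fin.last k ∧ q.2 = Fin.castSucc m)

/-- The product of the weights, split at the slot-`m` coordinates. [folklore] -/
theorem prod_wtj_eq (m : Fin k) (z : Fin (k + 1) → Ideal (𝓞 K)) :
    ∏ j, wtj (K := K) m j (z j) = (∏ i ∈ Finset.univ.erase m, w3 K (z (Fin.castSucc i))) *
      ((1 / idealTotient K (z (Fin.castSucc m))) * (1 / idealTotient K (z (Fin.last k)))) := by
  rw [Fin.prod_univ_castSucc]
  have hlast : wtj (K := K) m (Fin.last k) (z (Fin.last k)) = 1 / idealTotient K (z (Fin.last k)) := by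
    rw [wtj, if_pos (Or.inr rfl)]
  have hcs : ∀ i, wtj (K := K) m (Fin.castSucc i) (z (Fin.castSucc i)) =
      if i = m then 1 / idealTotient K (z (Fin.castSucc i)) else w3 K (z (Fin.castSucc i)) := by
    intro i
    rw [wtj]
    by_cases hi : i = m
    · rw [if_pos (Or.inl (by rw [hi])), if_pos hi]
    · rw [if_neg, if_neg hi]
      rintro (h | h)
      · exact hi (Fin.castSucc_injective _ h)
      · exact (Fin.castSucc_lt_last i).ne h
  rw [hlast, Finset.prod_congr rfl fun i _ => hcs i, ← Finset.mul_prod_erase _ _ (Finset.mem_univ m),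
    if_pos rfl, Finset.prod_congr rfl fun i hi => by rw [if_neg (Finset.mem_erase.1 hi).1]]
  ring

/-- A bad `(k+1)`-tuple (the first `k` coordinates, or those with slot `m` replaced by the last one,
not good) has an admissible pair of coordinates sharing a prime `𝔭 ∤ 𝔴` of norm `≤ R`. [folklore] -/
theorem exists_reqPair_of_bad {z : Fin (k + 1) → Ideal (𝓞 K)}
    (hz : ∀ j, z j ∈ G1 K 𝔴 B) (hbad : ¬(IsGood 𝔴 (zcs z) ∧ IsGood 𝔴 (zup m z))) :
    ∃ q ∈ reqPairs k m, ∃ P ∈ ((finite_primeIdealsLE K B).toFinset).filter (fun P => ¬ P ∣ 𝔴),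
      P ∣ z q.1 ∧ P ∣ z q.2 := by
  rw [not_and_or] at hbad
  rcases hbad with h | h
  · obtain ⟨ij, hij, P, hP, h1, h2⟩ := exists_prime_dvd_two_of_not_isGood (𝔲 := zcs z)
      (fun i => hz (Fin.castSucc i)) h
    rw [Finset.mem_offDiag] at hij
    refine ⟨(Fin.castSucc ij.1, Fin.castSucc ij.2), ?_, P, hP, h1, h2⟩
    rw [reqPairs, Finset.mem_filter]
    refine ⟨Finset.mem_univ _, fun h' => hij.2.2 (Fin.castSucc_injective _ h'), ?_, ?_⟩
    · rintro ⟨-, h'⟩; exact (Fin.castSucc_lt_last ij.2).ne h'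
    · rintro ⟨h', -⟩; exact (Fin.castSucc_lt_last ij.1).ne h'
  · have hzup : ∀ i, zup m z i ∈ G1 K 𝔴 B := fun i => by
      by_cases hi : i = m
      · subst hi; rw [zup, Function.update_self]; exact hz _
      · rw [zup, Function.update_of_ne hi]; exact hz _
    obtain ⟨ij, hij, P, hP, h1, h2⟩ := exists_prime_dvd_two_of_not_isGood hzup h
    rw [Finset.mem_offDiag] at hij
    -- the coordinate map `i ↦ J i`
    set J : Fin k → Fin (k + 1) := fun i => if i = m then Fin.last k else Fin.castSucc i with hJ
    have hJval : ∀ i, zup m z i = z (J i) := fun i => by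
      by_cases hi : i = m
      · subst hi; rw [zup, Function.update_self, hJ]; simp
      · rw [zup, Function.update_of_ne hi, hJ]; simp [hi, zcs]
    have hJinj : Function.Injective J := by
      intro a b hab
      simp only [hJ] at hab
      by_cases ha : a = m <;> by_cases hb : b = m
      · rw [ha, hb]
      · rw [if_pos ha, if_neg hb] at hab; exact absurd hab.symm (Fin.castSucc_lt_last b).ne
      · rw [if_neg ha, if_pos hb] at hab; exact absurd hab (Fin.castSucc_lt_last a).ne
      · rw [if_neg ha, if_neg hb] at hab; exact Fin.castSucc_injective _ hab
    have hJne : ∀ i, J i ≠ Fin.castSucc m := fun i => by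
      simp only [hJ]
      by_cases hi : i = m
      · rw [if_pos hi]; exact (Fin.castSucc_lt_last m).ne'
      · rw [if_neg hi]; exact fun h' => hi (Fin.castSucc_injective _ h')
    refine ⟨(J ij.1, J ij.2), ?_, P, hP, by rw [← hJval]; exact h1, by rw [← hJval]; exact h2⟩
    rw [reqPairs, Finset.mem_filter]
    exact ⟨Finset.mem_univ _, fun h' => hij.2.2 (hJinj h'), fun h' => hJne _ h'.1, fun h' => hJne _ h'.2⟩

/-- **Step C**: for `y = smoothY` (`y_𝔯 = F(x_𝔯)` on good tuples), the `(k+1)`-fold sum of Step B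
differs from the coordinatewise sum `∑_{z ∈ G1^{k+1}} (∏ⱼ wtⱼ(zⱼ)) F(x_{z'}) F(x_{z'[m↦𝔟]})` by at most
`F_max² |Q| (∏ⱼ Lⱼ) ∑_{𝔭 ∤ 𝔴, N𝔭 ≤ R} 4/N𝔭²` (only tuples with an admissible pair sharing a prime
`𝔭 ∤ 𝔴` contribute to the difference). [cite: MaynardAnnals2015, proof of Lemma 6.3 (removing (rᵢ,rⱼ)=1)] -/
theorem abs_sum_weightH_sub_le (h2 : ∀ P : Ideal (𝓞 K), Prime P → Ideal.absNorm P = 2 → P ∣ 𝔴)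
    (G : (Fin k → ℝ) → ℝ) {Fmax : ℝ} (hF : ∀ x, |(maynardSimplex k).indicator G x| ≤ Fmax) :
    |∑ z ∈ Fintype.piFinset (fun _ : Fin (k + 1) => G1 K 𝔴 B),
        (∏ j, wtj m j (z j)) * ((maynardSimplex k).indicator G (xOf B (zcs z)) *
          (maynardSimplex k).indicator G (xOf B (zup m z))) -
      ∑ z ∈ Fintype.piFinset (fun _ : Fin (k + 1) => G1 K 𝔴 B),
        (∏ i ∈ Finset.univ.erase m, w3 K (z (Fin.castSucc i))) *
          ((smoothY K k G B 𝔴 (zcs z) / idealTotient K (z (Fin.castSucc m))) *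
            (smoothY K k G B 𝔴 (zup m z) / idealTotient K (z (Fin.last k))))| ≤
      Fmax ^ 2 * ((reqPairs k m).card * (∏ j, ∑ 𝔞 ∈ G1 K 𝔴 B, wtj m j 𝔞) *
        ∑ P ∈ ((finite_primeIdealsLE K B).toFinset).filter (fun P => ¬ P ∣ 𝔴),
          4 / (Ideal.absNorm P : ℝ) ^ 2) := by
  classical
  set F := (maynardSimplex k).indicator G with hFdef
  have hF0 : 0 ≤ Fmax := (abs_nonneg _).trans (hF 0)
  -- weights: nonnegativity and the splitting bound
  have hwt0 : ∀ j, ∀ 𝔞 ∈ G1 K 𝔴 B, 0 ≤ wtj (K := K) m j 𝔞 := by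
    intro j 𝔞 ha
    rw [wtj]
    split_ifs
    · exact (one_div_pos.2 (idealTotient_pos_of_mem_G1 ha)).le
    · exact w3_nonneg_of_mem_G1 h2 ha
  have hwtP : ∀ j, ∀ P : Ideal (𝓞 K), Prime P → ¬ P ∣ 𝔴 → ∀ 𝔞 ∈ G1 K 𝔴 B, P ∣ 𝔞 →
      wtj (K := K) m j 𝔞 ≤ 2 / (Ideal.absNorm P : ℝ) * wtj m j (cof P 𝔞) := by
    intro j P hP _ 𝔞 ha hPa
    have hsq := (mem_G1.1 ha).2.1
    have hcof : cof P 𝔞 ∈ G1 K 𝔴 B := mem_G1_of_dvd ha ⟨P, by rw [mul_comm]; exact eq_mul_cof hPa⟩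
    rw [wtj, wtj]
    split_ifs
    · exact inv_idealTotient_le_of_dvd hP hsq hPa
    · exact w3_le_of_dvd hP hsq hPa (w3_nonneg_of_mem_G1 h2 hcof)
  -- termwise: the two summands agree on good configurations, the second vanishes on bad ones
  have hbox : ∀ z ∈ Fintype.piFinset (fun _ : Fin (k + 1) => G1 K 𝔴 B),
      zcs z ∈ box K k B ∧ zup m z ∈ box K k B := by
    intro z hz
    have hz' := Fintype.mem_piFinset.1 hz
    refine ⟨mem_box_iff.2 fun i => (mem_G1.1 (hz' _)).1, mem_box_iff.2 fun i => ?_⟩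
    by_cases hi : i = m
    · subst hi; rw [zup, Function.update_self]; exact (mem_G1.1 (hz' _)).1
    · rw [zup, Function.update_of_ne hi]; exact (mem_G1.1 (hz' _)).1
  rw [← Finset.sum_sub_distrib]
  have hterm : ∀ z ∈ Fintype.piFinset (fun _ : Fin (k + 1) => G1 K 𝔴 B),
      |(∏ j, wtj m j (z j)) * (F (xOf B (zcs z)) * F (xOf B (zup m z))) -
        (∏ i ∈ Finset.univ.erase m, w3 K (z (Fin.castSucc i))) *
          ((smoothY K k G B 𝔴 (zcs z) / idealTotient K (z (Fin.castSucc m))) *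
            (smoothY K k G B 𝔴 (zup m z) / idealTotient K (z (Fin.last k))))| ≤
      Fmax ^ 2 * (if ∃ q ∈ reqPairs k m, ∃ P ∈ ((finite_primeIdealsLE K B).toFinset).filter
          (fun P => ¬ P ∣ 𝔴), P ∣ z q.1 ∧ P ∣ z q.2 then ∏ j, wtj m j (z j) else 0) := by
    intro z hz
    have hz' := Fintype.mem_piFinset.1 hz
    have hW0 : 0 ≤ ∏ j, wtj (K := K) m j (z j) := Finset.prod_nonneg fun j _ => hwt0 j _ (hz' j)
    obtain ⟨hb1, hb2⟩ := hbox z hz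
    by_cases hgood : IsGood 𝔴 (zcs z) ∧ IsGood 𝔴 (zup m z)
    · -- equal
      have h1 : smoothY K k G B 𝔴 (zcs z) = F (xOf B (zcs z)) := by
        rw [smoothY, if_pos ⟨hb1, hgood.1⟩]; rfl
      have h2' : smoothY K k G B 𝔴 (zup m z) = F (xOf B (zup m z)) := by
        rw [smoothY, if_pos ⟨hb2, hgood.2⟩]; rfl
      rw [h1, h2', prod_wtj_eq]
      have : (∏ i ∈ Finset.univ.erase m, w3 K (z (Fin.castSucc i))) *
          ((1 / idealTotient K (z (Fin.castSucc m))) * (1 / idealTotient K (z (Fin.last k)))) *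
            (F (xOf B (zcs z)) * F (xOf B (zup m z))) -
          (∏ i ∈ Finset.univ.erase m, w3 K (z (Fin.castSucc i))) *
            ((F (xOf B (zcs z)) / idealTotient K (z (Fin.castSucc m))) *
              (F (xOf B (zup m z)) / idealTotient K (z (Fin.last k)))) = 0 := by ring
      rw [this, abs_zero]
      split_ifs
      · exact mul_nonneg (sq_nonneg _) (by rw [← prod_wtj_eq]; exact hW0)
      · rw [mul_zero]
    · -- the second summand vanishes; the first is bounded by `Fmax² W(z)`
      have h0 : smoothY K k G B 𝔴 (zcs z) * smoothY K k G B 𝔴 (zup m z) = 0 := by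
        rw [not_and_or] at hgood
        rcases hgood with h | h
        · rw [smoothY, if_neg (fun h' => h h'.2), zero_mul]
        · rw [mul_comm, smoothY, if_neg (fun h' => h h'.2), zero_mul]
      have hsecond : (∏ i ∈ Finset.univ.erase m, w3 K (z (Fin.castSucc i))) *
          ((smoothY K k G B 𝔴 (zcs z) / idealTotient K (z (Fin.castSucc m))) *
            (smoothY K k G B 𝔴 (zup m z) / idealTotient K (z (Fin.last k)))) = 0 := by
        rw [div_mul_div_comm, h0, zero_div, mul_zero]
      obtain ⟨q, hq, P, hP, hdvd⟩ := exists_reqPair_of_bad hz' hgood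
      rw [hsecond, sub_zero, if_pos ⟨q, hq, P, hP, hdvd⟩, abs_mul, abs_of_nonneg hW0, abs_mul, mul_comm]
      refine mul_le_mul_of_nonneg_right ?_ hW0
      rw [sq]
      exact mul_le_mul (hF _) (hF _) (abs_nonneg _) hF0
  refine (Finset.abs_sum_le_sum_abs _ _).trans ((Finset.sum_le_sum hterm).trans ?_)
  rw [← Finset.mul_sum, ← Finset.sum_filter]
  refine mul_le_mul_of_nonneg_left ?_ (sq_nonneg _)
  refine sum_prod_bad_pairs_le hwt0 hwtP (reqPairs k m) fun q hq => ?_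
  rw [reqPairs, Finset.mem_filter] at hq
  exact hq.2.1

end StepC

/-! ### Step D: the coordinatewise sum as an instance of the main-term evaluation -/

section StepD

variable {𝔴 : Ideal (𝓞 K)} {B : ℝ} {m : Fin k}

/-- The local parameters of the weights: `cPhi` at the two slot-`m` coordinates, `cW3` elsewhere.
[folklore] -/
def cwj (m : Fin k) (j : Fin (k + 1)) : Ideal (𝓞 K) → ℝ :=
  if j = Fin.castSucc m ∨ j = Fin.last k then cPhi else cW3

/-- `wtⱼ = W_{cⱼ}/N` on `G1`. [folklore] -/
theorem wtj_eq_sieveW_div {𝔞 : Ideal (𝓞 K)} (ha : 𝔞 ∈ G1 K 𝔴 B) (j : Fin (k + 1)) :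
    wtj m j 𝔞 = sieveW 𝔴 (cwj (K := K) m j) 𝔞 / ((Ideal.absNorm 𝔞 : ℕ) : ℝ) := by
  rw [wtj, cwj]
  split_ifs
  · exact (sieveW_cPhi_div_absNorm ha).symm
  · exact (sieveW_cW3_div_absNorm ha).symm

/-- `|cⱼ(𝔭)| ≤ 4/N𝔭`. [folklore] -/
theorem abs_cwj_le (m : Fin k) (j : Fin (k + 1)) {P : Ideal (𝓞 K)} (hP : Prime P) :
    |cwj (K := K) m j P| ≤ 4 / Ideal.absNorm P := by
  rw [cwj]
  split_ifs
  · exact abs_cPhi_le hP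
  · exact abs_cW3_le hP

/-- `1 + cⱼ(𝔭) ≥ 0`. [folklore] -/
theorem one_add_cwj_nonneg (m : Fin k) (j : Fin (k + 1)) {P : Ideal (𝓞 K)} (hP : Prime P) :
    0 ≤ 1 + cwj (K := K) m j P := by
  rw [cwj]
  split_ifs
  · exact one_add_cPhi_nonneg hP
  · exact one_add_cW3_nonneg hP

/-- The slot map `J_m : Fin k → Fin (k+1)`, `m ↦ last`, `i ↦ castSucc i` otherwise. [folklore] -/
def slotMap (m : Fin k) (i : Fin k) : Fin (k + 1) := if i = m then Fin.last k else Fin.castSucc i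

omit [NumberField K] in
/-- `J_m` is injective. [folklore] -/
theorem slotMap_injective (m : Fin k) : Function.Injective (slotMap m) := by
  intro a b hab
  simp only [slotMap] at hab
  by_cases ha : a = m <;> by_cases hb : b = m
  · rw [ha, hb]
  · rw [if_pos ha, if_neg hb] at hab; exact absurd hab.symm (Fin.castSucc_lt_last b).ne
  · rw [if_neg ha, if_pos hb] at hab; exact absurd hab (Fin.castSucc_lt_last a).ne
  · rw [if_neg ha, if_neg hb] at hab; exact Fin.castSucc_injective _ hab

/-- The two constraints of the polytope: `∑ᵢ ξ(castSucc i) ≤ 1` and `∑ᵢ ξ(J_m i) ≤ 1`. [folklore] -/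
def polyS (k : ℕ) (m : Fin k) (l : Fin 2) : Finset (Fin (k + 1)) :=
  if l = 0 then Finset.univ.image Fin.castSucc else Finset.univ.image (slotMap m)

/-- The continuous factor: `g(ξ) = G(ξ') G(ξ'[m ↦ ξ_last])`, `ξ'` the first `k` coordinates. [folklore] -/
def gfun (G : (Fin k → ℝ) → ℝ) (m : Fin k) (ξ : Fin (k + 1) → ℝ) : ℝ :=
  G (fun i => ξ (Fin.castSucc i)) * G (Function.update (fun i => ξ (Fin.castSucc i)) m (ξ (Fin.last k)))

/-- `H(ξ) = F(ξ') F(ξ'[m ↦ ξ_last])`, `F = 1_{R_k} G`. [cite: MaynardAnnals2015, proof of Lemma 6.3] -/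
def Hfun (G : (Fin k → ℝ) → ℝ) (m : Fin k) (ξ : Fin (k + 1) → ℝ) : ℝ :=
  (maynardSimplex k).indicator G (fun i => ξ (Fin.castSucc i)) *
    (maynardSimplex k).indicator G (Function.update (fun i => ξ (Fin.castSucc i)) m (ξ (Fin.last k)))

/-- The sums defining the two constraints. [folklore] -/
theorem sum_polyS (m : Fin k) (ξ : Fin (k + 1) → ℝ) :
    (∑ j ∈ polyS k m 0, ξ j = ∑ i, ξ (Fin.castSucc i)) ∧
      (∑ j ∈ polyS k m 1, ξ j = ∑ i, Function.update (fun i => ξ (Fin.castSucc i)) m (ξ (Fin.last k)) i) := by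
  constructor
  · rw [polyS, if_pos rfl, Finset.sum_image fun a _ b _ h => Fin.castSucc_injective _ h]
  · rw [polyS, if_neg (by decide), Finset.sum_image fun a _ b _ h => slotMap_injective m h]
    refine Finset.sum_congr rfl fun i _ => ?_
    by_cases hi : i = m
    · rw [hi, Function.update_self, slotMap, if_pos rfl]
    · rw [Function.update_of_ne hi, slotMap, if_neg hi]

/-- **On the cube, `H = 1_{polytope} g`.** [folklore] -/
theorem Hfun_eq_indicator (G : (Fin k → ℝ) → ℝ) (m : Fin k) {ξ : Fin (k + 1) → ℝ} (hξ : ξ ∈ maynardCube (k + 1)) :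
    Hfun G m ξ = (polytope (polyS k m)).indicator (gfun G m) ξ := by
  have hξ' := Set.mem_univ_pi.1 hξ
  have hnn : ∀ i, 0 ≤ ξ (Fin.castSucc i) := fun i => (hξ' _).1
  have hnn' : ∀ i, 0 ≤ Function.update (fun i => ξ (Fin.castSucc i)) m (ξ (Fin.last k)) i := fun i => by
    by_cases hi : i = m
    · rw [hi, Function.update_self]; exact (hξ' _).1
    · rw [Function.update_of_ne hi]; exact (hξ' _).1
  obtain ⟨hs0, hs1⟩ := sum_polyS m ξ
  rw [Hfun]
  by_cases hmem : ξ ∈ polytope (polyS k m)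
  · rw [Set.indicator_of_mem hmem, gfun]
    have h := (mem_polytope (S := polyS k m)).1 hmem
    rw [Set.indicator_of_mem, Set.indicator_of_mem]
    · exact ⟨hnn', by rw [← hs1]; exact h.2 1⟩
    · exact ⟨hnn, by rw [← hs0]; exact h.2 0⟩
  · rw [Set.indicator_of_notMem hmem]
    rw [mem_polytope, not_and_or] at hmem
    rcases hmem with h | h
    · exact absurd hξ h
    · rw [Fin.forall_fin_two, hs0, hs1, not_and_or] at h
      rcases h with hl | hl
      · rw [Set.indicator_of_notMem, zero_mul]
        rintro ⟨-, hsum⟩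
        exact hl hsum
      · rw [mul_comm, Set.indicator_of_notMem, zero_mul]
        rintro ⟨-, hsum⟩
        exact hl hsum

/-- The vector of logarithms of a `(k+1)`-tuple. [folklore] -/
def xz (R : ℝ) (z : Fin (k + 1) → Ideal (𝓞 K)) : Fin (k + 1) → ℝ :=
  fun j => Real.log (Ideal.absNorm (z j)) / Real.log R

/-- `H(x_z) = F(x_{z'}) F(x_{z'[m↦𝔟]})`. [folklore] -/
theorem Hfun_xz (G : (Fin k → ℝ) → ℝ) (m : Fin k) (R : ℝ) (z : Fin (k + 1) → Ideal (𝓞 K)) :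
    Hfun G m (xz R z) = (maynardSimplex k).indicator G (xOf R (zcs z)) *
      (maynardSimplex k).indicator G (xOf R (zup m z)) := by
  rw [Hfun]
  have h1 : (fun i => xz R z (Fin.castSucc i)) = xOf R (zcs z) := rfl
  have h2 : Function.update (fun i => xz R z (Fin.castSucc i)) m (xz R z (Fin.last k)) = xOf R (zup m z) := by
    funext i
    by_cases hi : i = m
    · rw [hi, Function.update_self, xOf, zup, Function.update_self]; rfl
    · rw [Function.update_of_ne hi, xOf, zup, Function.update_of_ne hi]; rfl
  rw [h2, h1]

/-- The log-vector of a tuple of `G1` lies in the cube (`R > 1`). [folklore] -/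
theorem xz_mem_maynardCube {R : ℝ} (hR : 1 < R) {z : Fin (k + 1) → Ideal (𝓞 K)} (hz : ∀ j, z j ∈ G1 K 𝔴 R) :
    xz R z ∈ maynardCube (k + 1) := by
  have hlogR : 0 < Real.log R := Real.log_pos hR
  refine Set.mem_univ_pi.2 fun j => ?_
  obtain ⟨⟨h0, hle⟩, -, -⟩ := mem_G1.1 (hz j)
  have h1 : (1 : ℝ) ≤ Ideal.absNorm (z j) := by
    exact_mod_cast Nat.one_le_iff_ne_zero.2 (by rwa [Ne, Ideal.absNorm_eq_zero_iff])
  refine ⟨div_nonneg (Real.log_nonneg h1) hlogR.le, ?_⟩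
  rw [xz, div_le_one hlogR]
  exact Real.log_le_log (by linarith) hle

/-- The polytope is measurable. [folklore] -/
theorem measurableSet_polytope' {ι' : Type*} [Fintype ι'] (S : ι' → Finset (Fin (k + 1))) :
    MeasurableSet (polytope S) := by
  have : polytope S = maynardCube (k + 1) ∩ ⋂ l, {t : Fin (k + 1) → ℝ | ∑ i ∈ S l, t i ≤ 1} := by
    ext t
    rw [mem_polytope, Set.mem_inter_iff, Set.mem_iInter]
    rfl
  rw [this]
  refine (MaynardLargeK.measurableSet_maynardCube _).inter (MeasurableSet.iInter fun l => ?_)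
  exact (isClosed_le (continuous_finsetSum _ fun i _ => continuous_apply i) continuous_const).measurableSet

/-- **Step D**: the coordinatewise sum of Step C is `(c log R)^{k+1} (∫_{[0,1]^{k+1}} 1_P g + error)`
with the error bracket of `MaynardNFMainTermC` (`ε, E` from the sharp one-dimensional estimate,
hypothesis `hsharp`). [cite: CastilloEtAl2015, proof of Proposition 2.1; MaynardAnnals2015, proof of Lemma 6.3] -/
theorem abs_sumWH_sub_integral_le {C Z : ℝ} (hC0 : 0 ≤ C)
    (hsharp : ∀ (𝔴 : Ideal (𝓞 K)), 𝔴 ≠ ⊥ → ∀ (c : Ideal (𝓞 K) → ℝ) (C₀ : ℝ),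
      0 ≤ C₀ → (∀ P : Ideal (𝓞 K), Prime P → |c P| ≤ C₀ / Ideal.absNorm P) → ∀ D₀ : ℝ, 1 ≤ D₀ →
      (∀ P : Ideal (𝓞 K), Prime P → (Ideal.absNorm P : ℝ) ≤ D₀ → P ∣ 𝔴) → ∀ x : ℝ, 1 ≤ x →
      |∑ 𝔲 ∈ idealsLE K x, sieveW 𝔴 c 𝔲 / ((Ideal.absNorm 𝔲 : ℕ) : ℝ) -
          dedekindZeta_residue K *
            (∑ 𝔢 ∈ idealDivisors K 𝔴, (idealMoebius 𝔢 : ℝ) / Ideal.absNorm 𝔢) * Real.log x| ≤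
        Real.exp ((1 + 2 * C₀) * Z) *
          ((∑ 𝔢 ∈ idealDivisors K 𝔴,
              (C + dedekindZeta_residue K * Real.log (Ideal.absNorm 𝔢)) / Ideal.absNorm 𝔢) +
            4 * dedekindZeta_residue K +
            dedekindZeta_residue K * D₀ ^ (-(1 : ℝ) / 4) * Real.log x))
    (h𝔴 : 𝔴 ≠ ⊥) {D₀ : ℝ} (hD₀ : 1 ≤ D₀)
    (hD : ∀ P : Ideal (𝓞 K), Prime P → (Ideal.absNorm P : ℝ) ≤ D₀ → P ∣ 𝔴)
    {R : ℝ} (hR : 1 < R) {M : ℕ} (hM : 0 < M) (G : (Fin k → ℝ) → ℝ) (m : Fin k)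
    {ω Gmax2 : ℝ} (hω : 0 ≤ ω) (hGmax2 : 0 ≤ Gmax2)
    (hcont : ∀ t ∈ maynardCube (k + 1), ∀ t' ∈ maynardCube (k + 1),
      (∀ j, |t j - t' j| ≤ 1 / (M : ℝ)) → |gfun G m t - gfun G m t'| ≤ ω)
    (hgb : ∀ t ∈ maynardCube (k + 1), |gfun G m t| ≤ Gmax2)
    (hint : IntegrableOn ((polytope (polyS k m)).indicator (gfun G m)) (maynardCube (k + 1)) volume)
    {d c ε E : ℝ} (hd : d = ∑ 𝔢 ∈ idealDivisors K 𝔴, (idealMoebius 𝔢 : ℝ) / Ideal.absNorm 𝔢)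
    (hc : c = dedekindZeta_residue K * d)
    (hε : ε = Real.exp ((1 + 2 * 4) * Z) * D₀ ^ (-(1 : ℝ) / 4) / d)
    (hE : E = Real.exp ((1 + 2 * 4) * Z) * ((∑ 𝔢 ∈ idealDivisors K 𝔴,
        (C + dedekindZeta_residue K * Real.log (Ideal.absNorm 𝔢)) / Ideal.absNorm 𝔢) +
          4 * dedekindZeta_residue K)) :
    |∑ z ∈ Fintype.piFinset (fun _ : Fin (k + 1) => G1 K 𝔴 R),
        (∏ j, wtj m j (z j)) * ((maynardSimplex k).indicator G (xOf R (zcs z)) *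
          (maynardSimplex k).indicator G (xOf R (zup m z))) -
        (c * Real.log R) ^ (k + 1) * ∫ t in maynardCube (k + 1), (polytope (polyS k m)).indicator (gfun G m) t| ≤
      (c * Real.log R) ^ (k + 1) *
        (((1 + 2 * M * (ε + E / (c * Real.log R))) ^ (k + 1) + 1) *
            (ω + 2 * Gmax2 * (∑ l, ((polyS k m l).card + 1 : ℝ)) / M) +
          Gmax2 * ((1 + 2 * M * (ε + E / (c * Real.log R))) ^ (k + 1) - 1)) := by
  have hsum : ∑ z ∈ Fintype.piFinset (fun _ : Fin (k + 1) => G1 K 𝔴 R),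
      (∏ j, wtj m j (z j)) * ((maynardSimplex k).indicator G (xOf R (zcs z)) *
        (maynardSimplex k).indicator G (xOf R (zup m z))) =
      ∑ z ∈ Fintype.piFinset (fun _ : Fin (k + 1) => G1 K 𝔴 R),
        (∏ j, sieveW 𝔴 (cwj m j) (z j) / ((Ideal.absNorm (z j) : ℕ) : ℝ)) *
          (polytope (polyS k m)).indicator (gfun G m) (fun j => Real.log (Ideal.absNorm (z j)) / Real.log R) := by
    refine Finset.sum_congr rfl fun z hz => ?_
    have hz' := Fintype.mem_piFinset.1 hz
    rw [Finset.prod_congr rfl fun j _ => wtj_eq_sieveW_div (hz' j) j, ← Hfun_xz,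
      Hfun_eq_indicator G m (xz_mem_maynardCube hR hz')]
    rfl
  rw [hsum]
  exact abs_sum_piFinset_G1_sub_integral_le_C (Nat.succ_pos k) hC0 hsharp h𝔴 hD₀ hD
    (cw := cwj m) (C₀ := 4) (by norm_num) (fun j P hP => abs_cwj_le m j hP)
    (fun j P hP => one_add_cwj_nonneg m j hP) hR hM (polyS k m) hω hGmax2 hcont hgb hint hd hc hε hE

end StepD

/-! ### Step E: `∫_{[0,1]^{k+1}} F(ξ') F(ξ'[m ↦ ξ_last]) dξ = J_k^{(m)}(F)` -/

section StepE

variable {n : ℕ}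

/-- A bounded a.e.-strongly measurable function on `ℝ × ℝ^{n'}` supported in `[0,1] × [0,1]^{n'}` is
integrable. [folklore] -/
theorem integrable_of_bounded_of_support {n' : ℕ} {φ : ℝ × (Fin n' → ℝ) → ℝ}
    (hφm : AEStronglyMeasurable φ volume) {C : ℝ} (hφb : ∀ p, ‖φ p‖ ≤ C)
    (hsupp : Function.support φ ⊆ Set.Icc (0 : ℝ) 1 ×ˢ maynardCube n') : Integrable φ := by
  have hs : MeasurableSet (Set.Icc (0 : ℝ) 1 ×ˢ maynardCube n') :=
    measurableSet_Icc.prod (MaynardLargeK.measurableSet_maynardCube n')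
  have hμ : volume (Set.Icc (0 : ℝ) 1 ×ˢ maynardCube n') ≠ ⊤ :=
    ((isCompact_Icc.prod (isCompact_univ_pi fun _ => isCompact_Icc)).measure_lt_top).ne
  have hg : Integrable ((Set.Icc (0 : ℝ) 1 ×ˢ maynardCube n').indicator (fun _ => C)) volume :=
    (integrableOn_const hμ).integrable_indicator hs
  refine hg.mono' hφm (ae_of_all _ fun p => ?_)
  by_cases hp : p ∈ Set.Icc (0 : ℝ) 1 ×ˢ maynardCube n'
  · rw [Set.indicator_of_mem hp]; exact hφb p
  · have : φ p = 0 := Function.notMem_support.1 fun h => hp (hsupp h)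
    rw [this, norm_zero, Set.indicator_of_notMem hp]

/-- **Step E**: for continuous `G` and `F = 1_{R_k} G` (`k = n + 1`),
`∫_{[0,1]^{k+1}} 1_P g = ∫_{[0,1]^{k+1}} F(ξ') F(ξ'[m↦ξ_last]) dξ = J_k^{(m)}(F)` (split off the last
coordinate and integrate it out against `F(ξ'[m ↦ ·])`, then split off the `m`-th coordinate of `ξ'`).
[cite: MaynardAnnals2015, proof of Lemma 6.3 (the integral J_k^{(m)})] -/
theorem integral_polytope_gfun_eq_maynardJ (G : (Fin (n + 1) → ℝ) → ℝ) (hG : Continuous G) (m : Fin (n + 1)) :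
    ∫ t in maynardCube (n + 1 + 1), (polytope (polyS (n + 1) m)).indicator (gfun G m) t =
      maynardJ (n + 1) m ((maynardSimplex (n + 1)).indicator G) := by
  obtain ⟨F, hF⟩ : ∃ F : (Fin (n + 1) → ℝ) → ℝ, F = (maynardSimplex (n + 1)).indicator G := ⟨_, rfl⟩
  have hFm : Measurable F := by rw [hF]; exact hG.measurable.indicator (measurableSet_maynardSimplex _)
  have hcubeK : IsCompact (maynardCube (n + 1)) := isCompact_univ_pi fun _ => isCompact_Icc
  obtain ⟨Gmax, hG0, hGmax⟩ : ∃ M : ℝ, 0 ≤ M ∧ ∀ x ∈ maynardCube (n + 1), |G x| ≤ M := by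
    obtain ⟨M, hM⟩ := hcubeK.exists_bound_of_continuousOn hG.continuousOn
    exact ⟨max M 0, le_max_right _ _, fun x hx =>
      (Real.norm_eq_abs (G x) ▸ hM x hx).trans (le_max_left _ _)⟩
  have hFb : ∀ x, |F x| ≤ Gmax := fun x => by rw [hF]; exact MaynardSieve.abs_indicator_simplex_le hG0 hGmax x
  -- replace the integrand by `H` on the cube
  have h1 : ∫ t in maynardCube (n + 1 + 1), (polytope (polyS (n + 1) m)).indicator (gfun G m) t =
      ∫ t in maynardCube (n + 1 + 1), Hfun G m t :=
    setIntegral_congr_fun (MaynardLargeK.measurableSet_maynardCube _) fun t ht => (Hfun_eq_indicator G m ht).symm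
  rw [h1, ← hF]
  have hHF : ∀ t, Hfun G m t = F (fun i => t (Fin.castSucc i)) *
      F (Function.update (fun i => t (Fin.castSucc i)) m (t (Fin.last (n + 1)))) := fun t => by rw [Hfun, hF]
  -- the fibre integrals
  obtain ⟨Ψ, hΨ⟩ : ∃ Ψ : (Fin (n + 1) → ℝ) → ℝ, Ψ = fun s => ∫ x in Set.Icc (0 : ℝ) 1, F (Function.update s m x) := ⟨_, rfl⟩
  obtain ⟨Φt, hΦt⟩ : ∃ Φt : (Fin n → ℝ) → ℝ, Φt = fun s' => ∫ u in (0 : ℝ)..1, F (Fin.insertNth m u s') := ⟨_, rfl⟩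
  have hΦtb : ∀ s', |Φt s'| ≤ Gmax := fun s' => by rw [hΦt, hF]; exact MaynardSieve.abs_fibreIntegral_le m hG0 hGmax s'
  have hΨins : ∀ (u : ℝ) (s' : Fin n → ℝ), Ψ (Fin.insertNth m u s') = Φt s' := by
    intro u s'
    rw [hΨ, hΦt]
    dsimp only
    simp_rw [Fin.update_insertNth]
    rw [intervalIntegral.integral_of_le zero_le_one, integral_Icc_eq_integral_Ioc]
  -- FIRST FUBINI: split off the last coordinate
  set e₁ := MeasurableEquiv.piFinSuccAbove (fun _ : Fin (n + 1 + 1) => ℝ) (Fin.last (n + 1)) with he₁_def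
  have he₁ : MeasurePreserving e₁.symm volume volume :=
    (volume_preserving_piFinSuccAbove (fun _ : Fin (n + 1 + 1) => ℝ) (Fin.last (n + 1))).symm
  have he₁_apply : ∀ p : ℝ × (Fin (n + 1) → ℝ), e₁.symm p = Fin.insertNth (Fin.last (n + 1)) p.1 p.2 := fun p => by
    rw [he₁_def, MeasurableEquiv.piFinSuccAbove_symm_apply]; rfl
  have hcs : ∀ (x : ℝ) (s : Fin (n + 1) → ℝ), (fun i => Fin.insertNth (α := fun _ => ℝ) (Fin.last (n + 1)) x s
      (Fin.castSucc i)) = s := by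
    intro x s; funext i
    rw [Fin.insertNth_last']; exact Fin.snoc_castSucc _ _ _
  have hlast : ∀ (x : ℝ) (s : Fin (n + 1) → ℝ), Fin.insertNth (α := fun _ => ℝ) (Fin.last (n + 1)) x s
      (Fin.last (n + 1)) = x := fun x s => by simp
  obtain ⟨Φ₁, hΦ₁⟩ : ∃ Φ₁ : ℝ × (Fin (n + 1) → ℝ) → ℝ, Φ₁ = fun p =>
      (Set.Icc (0 : ℝ) 1 ×ˢ maynardCube (n + 1)).indicator (fun p => F p.2 * F (Function.update p.2 m p.1)) p := ⟨_, rfl⟩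
  have hpt₁ : ∀ p : ℝ × (Fin (n + 1) → ℝ), (maynardCube (n + 1 + 1)).indicator (Hfun G m) (e₁.symm p) = Φ₁ p := by
    rintro ⟨x, s⟩
    rw [he₁_apply, hΦ₁]
    dsimp only
    by_cases hxs : (x, s) ∈ Set.Icc (0 : ℝ) 1 ×ˢ maynardCube (n + 1)
    · have hmem : Fin.insertNth (Fin.last (n + 1)) x s ∈ maynardCube (n + 1 + 1) :=
        (MaynardLargeK.insertNth_mem_maynardCube_iff _ x s).2 (Set.mem_prod.1 hxs)
      rw [Set.indicator_of_mem hmem, Set.indicator_of_mem hxs, hHF, hcs, hlast]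
    · have hnmem : Fin.insertNth (Fin.last (n + 1)) x s ∉ maynardCube (n + 1 + 1) := fun h =>
        hxs (Set.mem_prod.2 ((MaynardLargeK.insertNth_mem_maynardCube_iff _ x s).1 h))
      rw [Set.indicator_of_notMem hnmem, Set.indicator_of_notMem hxs]
  have hΦ₁int : Integrable Φ₁ (volume : Measure (ℝ × (Fin (n + 1) → ℝ))) := by
    refine integrable_of_bounded_of_support ?_ (C := Gmax * Gmax) (fun p => ?_) (by rw [hΦ₁]; exact Set.support_indicator_subset)
    · rw [hΦ₁]
      refine (Measurable.indicator ?_ (measurableSet_Icc.prod (MaynardLargeK.measurableSet_maynardCube _))).aestronglyMeasurable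
      refine Measurable.mul ?_ ?_
      · exact hFm.comp measurable_snd
      · exact hFm.comp (continuous_snd.update m continuous_fst).measurable
    · rw [hΦ₁, Real.norm_eq_abs]
      dsimp only
      by_cases hp : p ∈ Set.Icc (0 : ℝ) 1 ×ˢ maynardCube (n + 1)
      · rw [Set.indicator_of_mem hp, abs_mul]
        exact mul_le_mul (hFb _) (hFb _) (abs_nonneg _) hG0
      · rw [Set.indicator_of_notMem hp, abs_zero]; positivity
  have hinner₁ : ∀ s : Fin (n + 1) → ℝ, ∫ x, Φ₁ (x, s) = (maynardCube (n + 1)).indicator (fun s => F s * Ψ s) s := by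
    intro s
    rw [hΦ₁]
    dsimp only
    by_cases hs : s ∈ maynardCube (n + 1)
    · rw [Set.indicator_of_mem hs, hΨ]
      dsimp only
      rw [← integral_indicator measurableSet_Icc, ← integral_const_mul]
      refine integral_congr_ae (ae_of_all _ fun x => ?_)
      dsimp only
      by_cases hx : x ∈ Set.Icc (0 : ℝ) 1
      · rw [Set.indicator_of_mem (Set.mem_prod.2 ⟨hx, hs⟩), Set.indicator_of_mem hx]
      · rw [Set.indicator_of_notMem (fun h => hx (Set.mem_prod.1 h).1), Set.indicator_of_notMem hx, mul_zero]
    · rw [Set.indicator_of_notMem hs]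
      rw [show (fun x : ℝ => (Set.Icc (0 : ℝ) 1 ×ˢ maynardCube (n + 1)).indicator
        (fun p : ℝ × (Fin (n + 1) → ℝ) => F p.2 * F (Function.update p.2 m p.1)) (x, s)) = fun _ => 0 from
        funext fun x => Set.indicator_of_notMem (fun h => hs (Set.mem_prod.1 h).2) _]
      exact integral_zero _ _
  have hstep₁ : ∫ t in maynardCube (n + 1 + 1), Hfun G m t = ∫ s in maynardCube (n + 1), F s * Ψ s := by
    calc ∫ t in maynardCube (n + 1 + 1), Hfun G m t
        = ∫ t, (maynardCube (n + 1 + 1)).indicator (Hfun G m) t :=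
          (integral_indicator (MaynardLargeK.measurableSet_maynardCube _)).symm
      _ = ∫ p, (maynardCube (n + 1 + 1)).indicator (Hfun G m) (e₁.symm p) := (he₁.integral_comp' _).symm
      _ = ∫ p, Φ₁ p := integral_congr_ae (ae_of_all _ hpt₁)
      _ = ∫ s, ∫ x, Φ₁ (x, s) := by rw [Measure.volume_eq_prod]; exact integral_prod_symm Φ₁ hΦ₁int
      _ = ∫ s, (maynardCube (n + 1)).indicator (fun s => F s * Ψ s) s := integral_congr_ae (ae_of_all _ hinner₁)
      _ = ∫ s in maynardCube (n + 1), F s * Ψ s := integral_indicator (MaynardLargeK.measurableSet_maynardCube _)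
  rw [hstep₁]
  -- SECOND FUBINI: split off the `m`-th coordinate
  set e₂ := MeasurableEquiv.piFinSuccAbove (fun _ : Fin (n + 1) => ℝ) m with he₂_def
  have he₂ : MeasurePreserving e₂.symm volume volume :=
    (volume_preserving_piFinSuccAbove (fun _ : Fin (n + 1) => ℝ) m).symm
  have he₂_apply : ∀ p : ℝ × (Fin n → ℝ), e₂.symm p = Fin.insertNth m p.1 p.2 := fun p => by
    rw [he₂_def, MeasurableEquiv.piFinSuccAbove_symm_apply]; rfl
  obtain ⟨Φ₂, hΦ₂⟩ : ∃ Φ₂ : ℝ × (Fin n → ℝ) → ℝ, Φ₂ = fun p =>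
      (Set.Icc (0 : ℝ) 1 ×ˢ maynardCube n).indicator (fun p => F (Fin.insertNth m p.1 p.2) * Φt p.2) p := ⟨_, rfl⟩
  have hpt₂ : ∀ p : ℝ × (Fin n → ℝ), (maynardCube (n + 1)).indicator (fun s => F s * Ψ s) (e₂.symm p) = Φ₂ p := by
    rintro ⟨u, s'⟩
    rw [he₂_apply, hΦ₂]
    dsimp only
    by_cases hus : (u, s') ∈ Set.Icc (0 : ℝ) 1 ×ˢ maynardCube n
    · have hmem : Fin.insertNth m u s' ∈ maynardCube (n + 1) :=
        (MaynardLargeK.insertNth_mem_maynardCube_iff m u s').2 (Set.mem_prod.1 hus)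
      rw [Set.indicator_of_mem hmem, Set.indicator_of_mem hus, hΨins]
    · have hnmem : Fin.insertNth m u s' ∉ maynardCube (n + 1) := fun h =>
        hus (Set.mem_prod.2 ((MaynardLargeK.insertNth_mem_maynardCube_iff m u s').1 h))
      rw [Set.indicator_of_notMem hnmem, Set.indicator_of_notMem hus]
  have hΦtm : Measurable Φt := by
    rw [hΦt]; exact (MaynardLargeK.stronglyMeasurable_intervalIntegral_insertNth m hFm).measurable
  have hΦ₂int : Integrable Φ₂ (volume : Measure (ℝ × (Fin n → ℝ))) := by
    refine integrable_of_bounded_of_support ?_ (C := Gmax * Gmax) (fun p => ?_) (by rw [hΦ₂]; exact Set.support_indicator_subset)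
    · rw [hΦ₂]
      refine (Measurable.indicator ?_ (measurableSet_Icc.prod (MaynardLargeK.measurableSet_maynardCube _))).aestronglyMeasurable
      refine Measurable.mul ?_ ?_
      · exact hFm.comp (continuous_fst.finInsertNth m continuous_snd).measurable
      · exact hΦtm.comp measurable_snd
    · rw [hΦ₂, Real.norm_eq_abs]
      dsimp only
      by_cases hp : p ∈ Set.Icc (0 : ℝ) 1 ×ˢ maynardCube n
      · rw [Set.indicator_of_mem hp, abs_mul]
        exact mul_le_mul (hFb _) (hΦtb _) (abs_nonneg _) hG0
      · rw [Set.indicator_of_notMem hp, abs_zero]; positivity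
  have hinner₂ : ∀ s' : Fin n → ℝ, ∫ u, Φ₂ (u, s') = (maynardCube n).indicator (fun s' => Φt s' ^ 2) s' := by
    intro s'
    rw [hΦ₂]
    dsimp only
    by_cases hs : s' ∈ maynardCube n
    · rw [Set.indicator_of_mem hs, sq]
      have hΦt' : Φt s' = ∫ u in Set.Icc (0 : ℝ) 1, F (Fin.insertNth m u s') := by
        rw [hΦt]; dsimp only
        rw [intervalIntegral.integral_of_le zero_le_one, integral_Icc_eq_integral_Ioc]
      conv_rhs => rw [hΦt', ← integral_indicator measurableSet_Icc, ← integral_mul_const]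
      refine integral_congr_ae (ae_of_all _ fun u => ?_)
      dsimp only
      by_cases hu : u ∈ Set.Icc (0 : ℝ) 1
      · rw [Set.indicator_of_mem (Set.mem_prod.2 ⟨hu, hs⟩), Set.indicator_of_mem hu,
          integral_indicator measurableSet_Icc, ← hΦt']
      · rw [Set.indicator_of_notMem (fun h => hu (Set.mem_prod.1 h).1), Set.indicator_of_notMem hu, zero_mul]
    · rw [Set.indicator_of_notMem hs]
      rw [show (fun u : ℝ => (Set.Icc (0 : ℝ) 1 ×ˢ maynardCube n).indicator
        (fun p : ℝ × (Fin n → ℝ) => F (Fin.insertNth m p.1 p.2) * Φt p.2) (u, s')) = fun _ => 0 from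
        funext fun u => Set.indicator_of_notMem (fun h => hs (Set.mem_prod.1 h).2) _]
      exact integral_zero _ _
  have hFsupp : Function.support F ⊆ maynardSimplex (n + 1) := by rw [hF]; exact Set.support_indicator_subset
  calc ∫ s in maynardCube (n + 1), F s * Ψ s
      = ∫ s, (maynardCube (n + 1)).indicator (fun s => F s * Ψ s) s :=
        (integral_indicator (MaynardLargeK.measurableSet_maynardCube _)).symm
    _ = ∫ p, (maynardCube (n + 1)).indicator (fun s => F s * Ψ s) (e₂.symm p) := (he₂.integral_comp' _).symm
    _ = ∫ p, Φ₂ p := integral_congr_ae (ae_of_all _ hpt₂)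
    _ = ∫ s', ∫ u, Φ₂ (u, s') := by rw [Measure.volume_eq_prod]; exact integral_prod_symm Φ₂ hΦ₂int
    _ = ∫ s', (maynardCube n).indicator (fun s' => Φt s' ^ 2) s' := integral_congr_ae (ae_of_all _ hinner₂)
    _ = ∫ s' in maynardCube n, Φt s' ^ 2 := integral_indicator (MaynardLargeK.measurableSet_maynardCube _)
    _ = maynardJ (n + 1) m F := by rw [MaynardLargeK.maynardJ_eq_integral_insertNth m hFsupp, hΦt]
    _ = _ := by rw [hF]

end StepE

/-! ### The one-dimensional sums of the weights: `Lⱼ ≤ 3P` -/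

section Lbounds

variable {𝔴 : Ideal (𝓞 K)} {R : ℝ} {m : Fin k}

/-- `∑_{𝔞 ∈ G1} wtⱼ(𝔞) = ∑_{0 < N𝔲 ≤ R} W_{cⱼ}(𝔲)/N𝔲`. [folklore] -/
theorem sum_G1_wtj_eq (m : Fin k) (j : Fin (k + 1)) (𝔴 : Ideal (𝓞 K)) (R : ℝ) :
    ∑ 𝔞 ∈ G1 K 𝔴 R, wtj m j 𝔞 =
      ∑ 𝔲 ∈ idealsLE K R, sieveW 𝔴 (cwj (K := K) m j) 𝔲 / ((Ideal.absNorm 𝔲 : ℕ) : ℝ) := by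
  rw [Finset.sum_congr rfl fun 𝔞 ha => wtj_eq_sieveW_div ha j, G1, Finset.sum_filter]
  refine Finset.sum_congr rfl fun 𝔲 _ => ?_
  split_ifs with h
  · rfl
  · rw [sieveW, if_neg (fun h' => h ⟨h'.2, h'.1⟩), zero_div]

/-- **`∑ W_c/N ≤ 3 c_K d log R`** for general local parameters `|c_P| ≤ C₀/NP` (the twin of
`MaynardNFDiagonal.sum_G1_inv_idealTotient_le_three_mul` with `e^{(1+2C₀)Z}`).
[cite: CastilloEtAl2015, proof of Proposition 2.1] -/
theorem sum_idealsLE_sieveW_div_le_three_mul {C Z : ℝ} (hC0 : 0 ≤ C)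
    (hsharp : ∀ (𝔴 : Ideal (𝓞 K)), 𝔴 ≠ ⊥ → ∀ (c : Ideal (𝓞 K) → ℝ) (C₀ : ℝ),
      0 ≤ C₀ → (∀ P : Ideal (𝓞 K), Prime P → |c P| ≤ C₀ / Ideal.absNorm P) → ∀ D₀ : ℝ, 1 ≤ D₀ →
      (∀ P : Ideal (𝓞 K), Prime P → (Ideal.absNorm P : ℝ) ≤ D₀ → P ∣ 𝔴) → ∀ x : ℝ, 1 ≤ x →
      |∑ 𝔲 ∈ idealsLE K x, sieveW 𝔴 c 𝔲 / ((Ideal.absNorm 𝔲 : ℕ) : ℝ) -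
          dedekindZeta_residue K *
            (∑ 𝔢 ∈ idealDivisors K 𝔴, (idealMoebius 𝔢 : ℝ) / Ideal.absNorm 𝔢) * Real.log x| ≤
        Real.exp ((1 + 2 * C₀) * Z) *
          ((∑ 𝔢 ∈ idealDivisors K 𝔴,
              (C + dedekindZeta_residue K * Real.log (Ideal.absNorm 𝔢)) / Ideal.absNorm 𝔢) +
            4 * dedekindZeta_residue K +
            dedekindZeta_residue K * D₀ ^ (-(1 : ℝ) / 4) * Real.log x))
    (h𝔴 : 𝔴 ≠ ⊥) {D₀ : ℝ} (hD₀1 : 1 ≤ D₀)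
    (hD : ∀ P : Ideal (𝓞 K), Prime P → (Ideal.absNorm P : ℝ) ≤ D₀ → P ∣ 𝔴)
    (hR1 : 1 < R) {c : Ideal (𝓞 K) → ℝ} {C₀ : ℝ} (hC₀ : 0 ≤ C₀)
    (hc : ∀ P : Ideal (𝓞 K), Prime P → |c P| ≤ C₀ / Ideal.absNorm P) {Kc t : ℝ} (ht1 : t ≤ 1)
    (hKc : Kc = Real.exp ((1 + 2 * C₀) * Z) * (max C (dedekindZeta_residue K) + 4 * dedekindZeta_residue K))
    (hε1 : Real.exp ((1 + 2 * C₀) * Z) * (D₀ ^ (-(1 : ℝ) / 4) /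
      ∑ 𝔢 ∈ idealDivisors K 𝔴, (idealMoebius 𝔢 : ℝ) / Ideal.absNorm 𝔢) ≤ t)
    (hE2 : Kc / dedekindZeta_residue K *
      ((1 + ∑ 𝔢 ∈ idealDivisors K 𝔴, (1 + Real.log (Ideal.absNorm 𝔢)) / Ideal.absNorm 𝔢) /
        ((∑ 𝔢 ∈ idealDivisors K 𝔴, (idealMoebius 𝔢 : ℝ) / Ideal.absNorm 𝔢) * Real.log R)) ≤ t) :
    ∑ 𝔲 ∈ idealsLE K R, sieveW 𝔴 c 𝔲 / ((Ideal.absNorm 𝔲 : ℕ) : ℝ) ≤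
      3 * (dedekindZeta_residue K *
        (∑ 𝔢 ∈ idealDivisors K 𝔴, (idealMoebius 𝔢 : ℝ) / Ideal.absNorm 𝔢) * Real.log R) := by
  classical
  have hρ0 : 0 < dedekindZeta_residue K := dedekindZeta_residue_pos K
  have hlogR0 : 0 < Real.log R := Real.log_pos hR1
  obtain ⟨dN, hdNdef⟩ : ∃ x : ℝ, x = ∑ 𝔢 ∈ idealDivisors K 𝔴,
      (idealMoebius 𝔢 : ℝ) / Ideal.absNorm 𝔢 := ⟨_, rfl⟩
  have hdN0 : 0 < dN := by
    rw [hdNdef, dsum_eq_prod_one_sub_inv h𝔴]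
    refine Finset.prod_pos fun P hP => ?_
    have h2 : (2 : ℝ) ≤ Ideal.absNorm P := by
      exact_mod_cast two_le_absNorm_of_prime (prime_of_normalized_factor P (Multiset.mem_toFinset.1 hP))
    have : 1 / (Ideal.absNorm P : ℝ) ≤ 1 / 2 := one_div_le_one_div_of_le (by norm_num) h2
    linarith
  rw [← hdNdef] at hε1 hE2 ⊢
  obtain ⟨P, hP⟩ : ∃ x : ℝ, x = dedekindZeta_residue K * dN * Real.log R := ⟨_, rfl⟩
  have hP0 : 0 < P := by rw [hP]; positivity
  rw [← hP]
  obtain ⟨ε, hεdef⟩ : ∃ x : ℝ, x = Real.exp ((1 + 2 * C₀) * Z) * D₀ ^ (-(1 : ℝ) / 4) / dN := ⟨_, rfl⟩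
  have hε1' : ε ≤ 1 := by
    have : ε ≤ t := by rw [hεdef, mul_div_assoc]; exact hε1
    exact this.trans ht1
  have hεd : Real.exp ((1 + 2 * C₀) * Z) * D₀ ^ (-(1 : ℝ) / 4) = ε * dN := by rw [hεdef]; field_simp
  obtain ⟨Sg, hSg⟩ : ∃ x : ℝ, x = ∑ 𝔢 ∈ idealDivisors K 𝔴,
      (1 + Real.log (Ideal.absNorm 𝔢)) / Ideal.absNorm 𝔢 := ⟨_, rfl⟩
  rw [← hSg] at hE2
  have hSg0 : 0 ≤ Sg := by
    rw [hSg]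
    refine Finset.sum_nonneg fun 𝔢 h𝔢 => ?_
    have hN1 : (1 : ℝ) ≤ Ideal.absNorm 𝔢 := by
      exact_mod_cast Nat.one_le_iff_ne_zero.2 (by
        rw [Ne, Ideal.absNorm_eq_zero_iff]; exact ne_bot_of_mem_idealDivisors h𝔴 h𝔢)
    have := Real.log_nonneg hN1
    positivity
  obtain ⟨EC, hEC⟩ : ∃ x : ℝ, x = ∑ 𝔢 ∈ idealDivisors K 𝔴,
      (C + dedekindZeta_residue K * Real.log (Ideal.absNorm 𝔢)) / Ideal.absNorm 𝔢 := ⟨_, rfl⟩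
  have hECle : EC ≤ max C (dedekindZeta_residue K) * Sg := by
    rw [hEC, hSg]; exact divisorSum_le C (dedekindZeta_residue K) h𝔴
  obtain ⟨E, hEdef⟩ : ∃ x : ℝ, x = Real.exp ((1 + 2 * C₀) * Z) * (EC + 4 * dedekindZeta_residue K) := ⟨_, rfl⟩
  have hEP' : E ≤ t * P :=
    E_le_mul_of hEdef (Real.exp_pos _).le hρ0 hC0 hSg0 hECle hKc hP hdN0 hlogR0 hE2
  have hEP : E ≤ P := hEP'.trans (mul_le_of_le_one_left hP0.le ht1)
  have h := hsharp 𝔴 h𝔴 c C₀ hC₀ hc D₀ hD₀1 hD R hR1.le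
  rw [← hdNdef, ← hEC] at h
  exact L_le_three_mul hP hEdef hεd hε1' hEP (by positivity) (abs_sub_le_iff.1 h).1

/-- All the coordinate sums `Lⱼ = ∑_{G1} wtⱼ` are `≤ 3P` and `≥ 0` (primes of norm `2` dividing `𝔴`).
[cite: CastilloEtAl2015, proof of Proposition 2.1] -/
theorem sum_G1_wtj_le_three_mul {C Z : ℝ} (hC0 : 0 ≤ C)
    (hsharp : ∀ (𝔴 : Ideal (𝓞 K)), 𝔴 ≠ ⊥ → ∀ (c : Ideal (𝓞 K) → ℝ) (C₀ : ℝ),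
      0 ≤ C₀ → (∀ P : Ideal (𝓞 K), Prime P → |c P| ≤ C₀ / Ideal.absNorm P) → ∀ D₀ : ℝ, 1 ≤ D₀ →
      (∀ P : Ideal (𝓞 K), Prime P → (Ideal.absNorm P : ℝ) ≤ D₀ → P ∣ 𝔴) → ∀ x : ℝ, 1 ≤ x →
      |∑ 𝔲 ∈ idealsLE K x, sieveW 𝔴 c 𝔲 / ((Ideal.absNorm 𝔲 : ℕ) : ℝ) -
          dedekindZeta_residue K *
            (∑ 𝔢 ∈ idealDivisors K 𝔴, (idealMoebius 𝔢 : ℝ) / Ideal.absNorm 𝔢) * Real.log x| ≤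
        Real.exp ((1 + 2 * C₀) * Z) *
          ((∑ 𝔢 ∈ idealDivisors K 𝔴,
              (C + dedekindZeta_residue K * Real.log (Ideal.absNorm 𝔢)) / Ideal.absNorm 𝔢) +
            4 * dedekindZeta_residue K +
            dedekindZeta_residue K * D₀ ^ (-(1 : ℝ) / 4) * Real.log x))
    (h𝔴 : 𝔴 ≠ ⊥) {D₀ : ℝ} (hD₀1 : 1 ≤ D₀)
    (hD : ∀ P : Ideal (𝓞 K), Prime P → (Ideal.absNorm P : ℝ) ≤ D₀ → P ∣ 𝔴)
    (hR1 : 1 < R) {Kc t : ℝ} (ht1 : t ≤ 1)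
    (hKc : Kc = Real.exp ((1 + 2 * 4) * Z) * (max C (dedekindZeta_residue K) + 4 * dedekindZeta_residue K))
    (hε1 : Real.exp ((1 + 2 * 4) * Z) * (D₀ ^ (-(1 : ℝ) / 4) /
      ∑ 𝔢 ∈ idealDivisors K 𝔴, (idealMoebius 𝔢 : ℝ) / Ideal.absNorm 𝔢) ≤ t)
    (hE2 : Kc / dedekindZeta_residue K *
      ((1 + ∑ 𝔢 ∈ idealDivisors K 𝔴, (1 + Real.log (Ideal.absNorm 𝔢)) / Ideal.absNorm 𝔢) /
        ((∑ 𝔢 ∈ idealDivisors K 𝔴, (idealMoebius 𝔢 : ℝ) / Ideal.absNorm 𝔢) * Real.log R)) ≤ t)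
    (m : Fin k) (j : Fin (k + 1)) :
    ∑ 𝔞 ∈ G1 K 𝔴 R, wtj m j 𝔞 ≤
      3 * (dedekindZeta_residue K *
        (∑ 𝔢 ∈ idealDivisors K 𝔴, (idealMoebius 𝔢 : ℝ) / Ideal.absNorm 𝔢) * Real.log R) := by
  rw [sum_G1_wtj_eq]
  exact sum_idealsLE_sieveW_div_le_three_mul hC0 hsharp h𝔴 hD₀1 hD hR1 (by norm_num)
    (fun P hP => abs_cwj_le m j hP) ht1 hKc hε1 hE2

end Lbounds

/-! ### Real-variable bookkeeping for the assembly -/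

/-- Bookkeeping for Step A: with `L, L₃ ≤ 3P`, `1 ≤ Z`, `Z − 1 ≤ τ ≤ 1`,
`(2 G L E₀ + E₀²) L₃^n ≤ K_A τ P^{n+2}`, `E₀ = G (n+1) L (Z−1) Z^{n+1}`,
`K_A = (6 G c₁ + c₁²) 3^n`, `c₁ = 3 (n+1) 2^{n+1} G`. [folklore] -/
theorem termA_le {n : ℕ} {Gm L L₃ Z τ P : ℝ} (hG0 : 0 ≤ Gm) (hL0 : 0 ≤ L) (hL : L ≤ 3 * P)
    (hL₃0 : 0 ≤ L₃) (hL₃ : L₃ ≤ 3 * P) (hZ1 : 1 ≤ Z) (hZτ : Z - 1 ≤ τ) (hτ0 : 0 ≤ τ) (hτ1 : τ ≤ 1)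
    (hP0 : 0 ≤ P) :
    (2 * Gm * L * (Gm * (((n + 1 : ℕ) : ℝ) * (L * ((Z - 1) * Z ^ (n + 1))))) +
        (Gm * (((n + 1 : ℕ) : ℝ) * (L * ((Z - 1) * Z ^ (n + 1))))) ^ 2) * L₃ ^ n ≤
      ((6 * Gm * (3 * (n + 1) * 2 ^ (n + 1) * Gm) + (3 * (n + 1) * 2 ^ (n + 1) * Gm) ^ 2) * 3 ^ n) *
        τ * P ^ (n + 2) := by
  obtain ⟨c₁, hc₁⟩ : ∃ x : ℝ, x = 3 * (n + 1) * 2 ^ (n + 1) * Gm := ⟨_, rfl⟩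
  rw [← hc₁]
  have hc₁0 : 0 ≤ c₁ := by rw [hc₁]; positivity
  obtain ⟨E₀, hE₀⟩ : ∃ x : ℝ, x = Gm * (((n + 1 : ℕ) : ℝ) * (L * ((Z - 1) * Z ^ (n + 1)))) := ⟨_, rfl⟩
  rw [← hE₀]
  have hZ2 : Z ≤ 2 := by linarith
  have hZ0 : 0 ≤ Z := by linarith
  have hZm1 : 0 ≤ Z - 1 := by linarith
  -- `E₀ ≤ c₁ τ P`
  have hE₀le : E₀ ≤ c₁ * τ * P := by
    have h1 : ((Z - 1) * Z ^ (n + 1)) ≤ τ * 2 ^ (n + 1) :=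
      mul_le_mul hZτ (pow_le_pow_left₀ hZ0 hZ2 _) (by positivity) hτ0
    have h2 : L * ((Z - 1) * Z ^ (n + 1)) ≤ (3 * P) * (τ * 2 ^ (n + 1)) :=
      mul_le_mul hL h1 (by positivity) (by positivity)
    calc E₀ = Gm * (((n + 1 : ℕ) : ℝ) * (L * ((Z - 1) * Z ^ (n + 1)))) := hE₀
      _ ≤ Gm * (((n + 1 : ℕ) : ℝ) * ((3 * P) * (τ * 2 ^ (n + 1)))) :=
          mul_le_mul_of_nonneg_left (mul_le_mul_of_nonneg_left h2 (by positivity)) hG0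
      _ = c₁ * τ * P := by rw [hc₁]; push_cast; ring
  have hE₀0 : 0 ≤ E₀ := by rw [hE₀]; positivity
  have hcτP : 0 ≤ c₁ * τ * P := by positivity
  -- the bracket
  have hbr : 2 * Gm * L * E₀ + E₀ ^ 2 ≤ (6 * Gm * c₁ + c₁ ^ 2) * τ * P ^ 2 := by
    have h1 : 2 * Gm * L * E₀ ≤ 2 * Gm * (3 * P) * (c₁ * τ * P) :=
      mul_le_mul (mul_le_mul_of_nonneg_left hL (by positivity)) hE₀le hE₀0 (by positivity)
    have h2 : E₀ ^ 2 ≤ (c₁ * τ * P) ^ 2 := pow_le_pow_left₀ hE₀0 hE₀le 2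
    have h3 : (c₁ * τ * P) ^ 2 ≤ c₁ ^ 2 * τ * P ^ 2 := by
      have : τ ^ 2 ≤ τ := by nlinarith
      calc (c₁ * τ * P) ^ 2 = c₁ ^ 2 * τ ^ 2 * P ^ 2 := by ring
        _ ≤ c₁ ^ 2 * τ * P ^ 2 := by
            refine mul_le_mul_of_nonneg_right (mul_le_mul_of_nonneg_left this (sq_nonneg _)) (sq_nonneg _)
    calc 2 * Gm * L * E₀ + E₀ ^ 2 ≤ 2 * Gm * (3 * P) * (c₁ * τ * P) + c₁ ^ 2 * τ * P ^ 2 :=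
          add_le_add h1 (h2.trans h3)
      _ = (6 * Gm * c₁ + c₁ ^ 2) * τ * P ^ 2 := by ring
  have hL₃n : L₃ ^ n ≤ (3 * P) ^ n := pow_le_pow_left₀ hL₃0 hL₃ n
  have hbr0 : 0 ≤ 2 * Gm * L * E₀ + E₀ ^ 2 := by positivity
  calc (2 * Gm * L * E₀ + E₀ ^ 2) * L₃ ^ n ≤ ((6 * Gm * c₁ + c₁ ^ 2) * τ * P ^ 2) * (3 * P) ^ n :=
        mul_le_mul hbr hL₃n (pow_nonneg hL₃0 n) (by positivity)
    _ = _ := by rw [mul_pow]; ring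

/-- Bookkeeping for Step C: `G² (|Q| (∏ⱼ Lⱼ) S₄) ≤ K_C D₀^{-1/2} P^{n+2}` when `|Q| ≤ (n+2)²`,
`∏ⱼ Lⱼ ≤ (3P)^{n+2}`, `S₄ ≤ 16 D₀^{-1/2} Z₃`; `K_C = G² (n+2)² 3^{n+2} 16 Z₃`. [folklore] -/
theorem termC_le {n : ℕ} {Gm Qc PiL S₄ Dh Z₃ P : ℝ} (hQ : Qc ≤ ((n : ℝ) + 2) ^ 2)
    (hPi0 : 0 ≤ PiL) (hPi : PiL ≤ (3 * P) ^ (n + 2)) (hS0 : 0 ≤ S₄) (hS : S₄ ≤ 16 * Dh * Z₃)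
    (hP0 : 0 ≤ P) :
    Gm ^ 2 * (Qc * PiL * S₄) ≤ (Gm ^ 2 * ((n : ℝ) + 2) ^ 2 * 3 ^ (n + 2) * 16 * Z₃) * Dh * P ^ (n + 2) := by
  have h1 : Qc * PiL * S₄ ≤ ((n : ℝ) + 2) ^ 2 * (3 * P) ^ (n + 2) * (16 * Dh * Z₃) :=
    mul_le_mul (mul_le_mul hQ hPi hPi0 (by positivity)) hS hS0 (by positivity)
  calc Gm ^ 2 * (Qc * PiL * S₄) ≤ Gm ^ 2 * (((n : ℝ) + 2) ^ 2 * (3 * P) ^ (n + 2) * (16 * Dh * Z₃)) :=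
        mul_le_mul_of_nonneg_left h1 (sq_nonneg _)
    _ = _ := by rw [mul_pow]; ring

/-! ### The assembly at fixed parameters -/

section Core

variable {n : ℕ}

/-- `∑_{G1} 1/φ` and `∑_{G1} w₃` as sums of `W_c/N` over all ideals of norm `≤ R`. [folklore] -/
theorem sum_G1_inv_idealTotient_eq_sieveW (𝔴 : Ideal (𝓞 K)) (R : ℝ) :
    (∑ 𝔞 ∈ G1 K 𝔴 R, 1 / idealTotient K 𝔞 =
      ∑ 𝔲 ∈ idealsLE K R, sieveW 𝔴 cPhi 𝔲 / ((Ideal.absNorm 𝔲 : ℕ) : ℝ)) ∧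
    (∑ 𝔞 ∈ G1 K 𝔴 R, w3 K 𝔞 =
      ∑ 𝔲 ∈ idealsLE K R, sieveW 𝔴 cW3 𝔲 / ((Ideal.absNorm 𝔲 : ℕ) : ℝ)) := by
  constructor
  · rw [Finset.sum_congr rfl fun 𝔞 ha => (sieveW_cPhi_div_absNorm ha).symm, G1, Finset.sum_filter]
    refine Finset.sum_congr rfl fun 𝔲 _ => ?_
    split_ifs with h
    · rfl
    · rw [sieveW, if_neg (fun h' => h ⟨h'.2, h'.1⟩), zero_div]
  · rw [Finset.sum_congr rfl fun 𝔞 ha => (sieveW_cW3_div_absNorm ha).symm, G1, Finset.sum_filter]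
    refine Finset.sum_congr rfl fun 𝔲 _ => ?_
    split_ifs with h
    · rfl
    · rw [sieveW, if_neg (fun h' => h ⟨h'.2, h'.1⟩), zero_div]

/-- `|g| ≤ G_max²` on the cube. [folklore] -/
theorem abs_gfun_le {G : (Fin (n + 1) → ℝ) → ℝ} {Gmax : ℝ} (hG0 : 0 ≤ Gmax)
    (hGmax : ∀ x ∈ maynardCube (n + 1), |G x| ≤ Gmax) (m : Fin (n + 1))
    {t : Fin (n + 1 + 1) → ℝ} (ht : t ∈ maynardCube (n + 1 + 1)) : |gfun G m t| ≤ Gmax ^ 2 := by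
  have ht' := Set.mem_univ_pi.1 ht
  have ha : (fun i => t (Fin.castSucc i)) ∈ maynardCube (n + 1) := Set.mem_univ_pi.2 fun i => ht' _
  have hb : Function.update (fun i => t (Fin.castSucc i)) m (t (Fin.last (n + 1))) ∈ maynardCube (n + 1) := by
    refine Set.mem_univ_pi.2 fun i => ?_
    by_cases hi : i = m
    · rw [hi, Function.update_self]; exact ht' _
    · rw [Function.update_of_ne hi]; exact ht' _
  rw [gfun, abs_mul, sq]
  exact mul_le_mul (hGmax _ ha) (hGmax _ hb) (abs_nonneg _) hG0

/-- **Steps D + E at fixed parameters**: with the smallness conditions of `MaynardNFDiagonal.diag_core`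
(for `e^{9Z}`), `|∑_{z ∈ G1^{k+1}} (∏ wtⱼ(zⱼ)) F(x_{z'})F(x_{z'[m↦𝔟]}) − P^{k+1} J_k^{(m)}(F)| ≤ (ε₁/2) P^{k+1}`.
[cite: CastilloEtAl2015, proof of Proposition 2.1; MaynardAnnals2015, proof of Lemma 6.3] -/
theorem S2sum_core_D {C Z : ℝ} (hC0 : 0 ≤ C)
    (hsharp : ∀ (𝔴 : Ideal (𝓞 K)), 𝔴 ≠ ⊥ → ∀ (c : Ideal (𝓞 K) → ℝ) (C₀ : ℝ),
      0 ≤ C₀ → (∀ P : Ideal (𝓞 K), Prime P → |c P| ≤ C₀ / Ideal.absNorm P) → ∀ D₀ : ℝ, 1 ≤ D₀ →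
      (∀ P : Ideal (𝓞 K), Prime P → (Ideal.absNorm P : ℝ) ≤ D₀ → P ∣ 𝔴) → ∀ x : ℝ, 1 ≤ x →
      |∑ 𝔲 ∈ idealsLE K x, sieveW 𝔴 c 𝔲 / ((Ideal.absNorm 𝔲 : ℕ) : ℝ) -
          dedekindZeta_residue K *
            (∑ 𝔢 ∈ idealDivisors K 𝔴, (idealMoebius 𝔢 : ℝ) / Ideal.absNorm 𝔢) * Real.log x| ≤
        Real.exp ((1 + 2 * C₀) * Z) *
          ((∑ 𝔢 ∈ idealDivisors K 𝔴,
              (C + dedekindZeta_residue K * Real.log (Ideal.absNorm 𝔢)) / Ideal.absNorm 𝔢) +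
            4 * dedekindZeta_residue K +
            dedekindZeta_residue K * D₀ ^ (-(1 : ℝ) / 4) * Real.log x))
    {𝔴 : Ideal (𝓞 K)} (h𝔴 : 𝔴 ≠ ⊥) {D₀ : ℝ} (hD₀1 : 1 ≤ D₀)
    (hD : ∀ P : Ideal (𝓞 K), Prime P → (Ideal.absNorm P : ℝ) ≤ D₀ → P ∣ 𝔴)
    {R : ℝ} (hR1 : 1 < R) {M : ℕ} (hMpos : 0 < M) {G : (Fin (n + 1) → ℝ) → ℝ} (hG : Continuous G)
    (m : Fin (n + 1)) {ε₁ Gmax η₀ A Kc : ℝ} (hε₁0 : 0 < ε₁) (hε₁1 : ε₁ ≤ 1) (hG0 : 0 ≤ Gmax)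
    (hGmax : ∀ x ∈ maynardCube (n + 1), |G x| ≤ Gmax)
    (hcont : ∀ t ∈ maynardCube (n + 1 + 1), ∀ t' ∈ maynardCube (n + 1 + 1),
      (∀ j, |t j - t' j| ≤ 1 / (M : ℝ)) → |gfun G m t - gfun G m t'| ≤ ε₁ / 16)
    (hint : IntegrableOn ((polytope (polyS (n + 1) m)).indicator (gfun G m)) (maynardCube (n + 1 + 1)) volume)
    (hq : 2 * Gmax ^ 2 * (∑ l, ((polyS (n + 1) m l).card + 1 : ℝ)) / M ≤ ε₁ / 32)
    (hη₀0 : 0 < η₀) (hη₀1 : η₀ ≤ 1)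
    (hA : A = Gmax ^ 2 * ((n + 1 + 1 : ℕ) : ℝ) * 2 ^ (n + 1 + 1 - 1) + ((n + 1 + 1 : ℕ) : ℝ) * 2 ^ (n + 1 + 1 - 1) + 1)
    (hη₀A : A * η₀ ≤ ε₁ / 8)
    (hKc : Kc = Real.exp ((1 + 2 * 4) * Z) * (max C (dedekindZeta_residue K) + 4 * dedekindZeta_residue K))
    (hε1 : Real.exp ((1 + 2 * 4) * Z) * (D₀ ^ (-(1 : ℝ) / 4) /
      ∑ 𝔢 ∈ idealDivisors K 𝔴, (idealMoebius 𝔢 : ℝ) / Ideal.absNorm 𝔢) ≤ η₀ / (4 * M))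
    (hE2 : Kc / dedekindZeta_residue K *
      ((1 + ∑ 𝔢 ∈ idealDivisors K 𝔴, (1 + Real.log (Ideal.absNorm 𝔢)) / Ideal.absNorm 𝔢) /
        ((∑ 𝔢 ∈ idealDivisors K 𝔴, (idealMoebius 𝔢 : ℝ) / Ideal.absNorm 𝔢) * Real.log R)) ≤
      η₀ / (4 * M)) :
    |∑ z ∈ Fintype.piFinset (fun _ : Fin (n + 1 + 1) => G1 K 𝔴 R),
        (∏ j, wtj m j (z j)) * ((maynardSimplex (n + 1)).indicator G (xOf R (zcs z)) *
          (maynardSimplex (n + 1)).indicator G (xOf R (zup m z))) -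
        (dedekindZeta_residue K *
            (∑ 𝔢 ∈ idealDivisors K 𝔴, (idealMoebius 𝔢 : ℝ) / Ideal.absNorm 𝔢) * Real.log R) ^ (n + 1 + 1) *
          maynardJ (n + 1) m ((maynardSimplex (n + 1)).indicator G)| ≤
      (dedekindZeta_residue K *
        (∑ 𝔢 ∈ idealDivisors K 𝔴, (idealMoebius 𝔢 : ℝ) / Ideal.absNorm 𝔢) * Real.log R) ^ (n + 1 + 1) *
        (ε₁ / 2) := by
  classical
  have hρ0 : 0 < dedekindZeta_residue K := dedekindZeta_residue_pos K
  have hM0 : (0 : ℝ) < M := by exact_mod_cast hMpos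
  have hM1' : (1 : ℝ) ≤ M := by exact_mod_cast hMpos
  have hηM1 : η₀ / (4 * M) ≤ 1 := by
    rw [div_le_one (by positivity)]; nlinarith
  have hlogR0 : 0 < Real.log R := Real.log_pos hR1
  have hH2 : 0 ≤ Gmax ^ 2 := by positivity
  obtain ⟨dN, hdNdef⟩ : ∃ x : ℝ, x = ∑ 𝔢 ∈ idealDivisors K 𝔴,
      (idealMoebius 𝔢 : ℝ) / Ideal.absNorm 𝔢 := ⟨_, rfl⟩
  have hdN0 : 0 < dN := by
    rw [hdNdef, dsum_eq_prod_one_sub_inv h𝔴]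
    refine Finset.prod_pos fun P hP => ?_
    have h2 : (2 : ℝ) ≤ Ideal.absNorm P := by
      exact_mod_cast two_le_absNorm_of_prime (prime_of_normalized_factor P (Multiset.mem_toFinset.1 hP))
    have : 1 / (Ideal.absNorm P : ℝ) ≤ 1 / 2 := one_div_le_one_div_of_le (by norm_num) h2
    linarith
  rw [← hdNdef] at hε1 hE2 ⊢
  obtain ⟨P, hP⟩ : ∃ x : ℝ, x = dedekindZeta_residue K * dN * Real.log R := ⟨_, rfl⟩
  have hP0 : 0 < P := by rw [hP]; positivity
  have hPeq : dedekindZeta_residue K * dN * Real.log R = P := hP.symm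
  rw [hPeq]
  obtain ⟨ε, hεdef⟩ : ∃ x : ℝ, x = Real.exp ((1 + 2 * 4) * Z) * D₀ ^ (-(1 : ℝ) / 4) / dN := ⟨_, rfl⟩
  have hε0 : 0 ≤ ε := by rw [hεdef]; positivity
  have hεle : ε ≤ η₀ / (4 * M) := by rw [hεdef, mul_div_assoc]; exact hε1
  obtain ⟨Sg, hSg⟩ : ∃ x : ℝ, x = ∑ 𝔢 ∈ idealDivisors K 𝔴,
      (1 + Real.log (Ideal.absNorm 𝔢)) / Ideal.absNorm 𝔢 := ⟨_, rfl⟩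
  rw [← hSg] at hE2
  have hSg0 : 0 ≤ Sg := by
    rw [hSg]
    refine Finset.sum_nonneg fun 𝔢 h𝔢 => ?_
    have hN1 : (1 : ℝ) ≤ Ideal.absNorm 𝔢 := by
      exact_mod_cast Nat.one_le_iff_ne_zero.2 (by
        rw [Ne, Ideal.absNorm_eq_zero_iff]; exact ne_bot_of_mem_idealDivisors h𝔴 h𝔢)
    have := Real.log_nonneg hN1
    positivity
  obtain ⟨EC, hEC⟩ : ∃ x : ℝ, x = ∑ 𝔢 ∈ idealDivisors K 𝔴,
      (C + dedekindZeta_residue K * Real.log (Ideal.absNorm 𝔢)) / Ideal.absNorm 𝔢 := ⟨_, rfl⟩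
  have hECle : EC ≤ max C (dedekindZeta_residue K) * Sg := by
    rw [hEC, hSg]; exact divisorSum_le C (dedekindZeta_residue K) h𝔴
  obtain ⟨E, hEdef⟩ : ∃ x : ℝ, x = Real.exp ((1 + 2 * 4) * Z) * (EC + 4 * dedekindZeta_residue K) := ⟨_, rfl⟩
  have hE0 : 0 ≤ E := by
    have hEC0 : 0 ≤ EC := by
      rw [hEC]
      refine Finset.sum_nonneg fun 𝔢 h𝔢 => ?_
      have hN1 : (1 : ℝ) ≤ Ideal.absNorm 𝔢 := by
        exact_mod_cast Nat.one_le_iff_ne_zero.2 (by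
          rw [Ne, Ideal.absNorm_eq_zero_iff]; exact ne_bot_of_mem_idealDivisors h𝔴 h𝔢)
      have := Real.log_nonneg hN1
      positivity
    rw [hEdef]; positivity
  have hEP' : E ≤ η₀ / (4 * M) * P :=
    E_le_mul_of hEdef (Real.exp_pos _).le hρ0 hC0 hSg0 hECle hKc hP hdN0 hlogR0 hE2
  have hEPdiv : E / P ≤ η₀ / (4 * M) := by rw [div_le_iff₀ hP0]; exact hEP'
  -- Steps D and E
  have hc : dedekindZeta_residue K * dN = dedekindZeta_residue K * dN := rfl
  have hEdef' : E = Real.exp ((1 + 2 * 4) * Z) * ((∑ 𝔢 ∈ idealDivisors K 𝔴,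
      (C + dedekindZeta_residue K * Real.log (Ideal.absNorm 𝔢)) / Ideal.absNorm 𝔢) +
        4 * dedekindZeta_residue K) := by rw [hEdef, hEC]
  have hgb : ∀ t ∈ maynardCube (n + 1 + 1), |gfun G m t| ≤ Gmax ^ 2 := fun t ht => abs_gfun_le hG0 hGmax m ht
  have hmain := abs_sumWH_sub_integral_le hC0 hsharp h𝔴 hD₀1 hD hR1 hMpos G m
    (by positivity : (0 : ℝ) ≤ ε₁ / 16) hH2 hcont hgb hint (d := dN) (c := dedekindZeta_residue K * dN)
    (ε := ε) (E := E) hdNdef hc hεdef hEdef'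
  rw [integral_polytope_gfun_eq_maynardJ G hG m, hPeq] at hmain
  -- `η ≤ η₀`
  obtain ⟨η, hηdef⟩ : ∃ e : ℝ, e = 2 * M * (ε + E / P) := ⟨_, rfl⟩
  rw [← hηdef] at hmain
  have hη0 : 0 ≤ η := by rw [hηdef]; positivity
  have hηle : η ≤ η₀ := by
    calc η = 2 * M * (ε + E / P) := hηdef
      _ ≤ 2 * M * (η₀ / (4 * M) + η₀ / (4 * M)) :=
          mul_le_mul_of_nonneg_left (add_le_add hεle hEPdiv) (by positivity)
      _ = η₀ := by field_simp; ring
  have hη1 : η ≤ 1 := hηle.trans hη₀1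
  obtain ⟨hηk, hηk'⟩ := eta_bounds (k := n + 1 + 1) hH2 hηle hη₀0.le hA hη₀A hε₁1
  have hq0 : (0 : ℝ) ≤ 2 * Gmax ^ 2 * (∑ l, ((polyS (n + 1) m l).card + 1 : ℝ)) / M := by positivity
  have hbr := MaynardSieve.bracket_le (k := n + 1 + 1) (H := Gmax ^ 2) (ε := ε₁) hH2 hη0 rfl hq0 hq hηk hηk' hη1
  exact hmain.trans (mul_le_mul_of_nonneg_left hbr (pow_pos hP0 _).le)

/-- **The main term of `S₂^{(m)}` at fixed parameters** (Castillo et al., proof of Proposition 2.1,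
`S₂` part = Maynard's Lemma 6.3 over `𝓞_K`): under the smallness conditions of `S2sum_core_D`, the
junk bounds `K_A τ ≤ ε₁/8` (`∑_{G1} 1/φ² − 1 ≤ τ ≤ 1`) and `K_C D₀^{-1/2} ≤ ε₁/8`,
`|∑_{𝔲 good} (y^{(m)}_𝔲)²/∏ g(𝔲ᵢ) − P^{k+1} J_k^{(m)}(F)| ≤ (3ε₁/4) P^{k+1}`, `P = c_K d log R`.
[cite: CastilloEtAl2015, proof of Proposition 2.1; MaynardAnnals2015, Lemmas 5.3 and 6.3] -/
theorem S2sum_core {C Z : ℝ} (hC0 : 0 ≤ C)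
    (hsharp : ∀ (𝔴 : Ideal (𝓞 K)), 𝔴 ≠ ⊥ → ∀ (c : Ideal (𝓞 K) → ℝ) (C₀ : ℝ),
      0 ≤ C₀ → (∀ P : Ideal (𝓞 K), Prime P → |c P| ≤ C₀ / Ideal.absNorm P) → ∀ D₀ : ℝ, 1 ≤ D₀ →
      (∀ P : Ideal (𝓞 K), Prime P → (Ideal.absNorm P : ℝ) ≤ D₀ → P ∣ 𝔴) → ∀ x : ℝ, 1 ≤ x →
      |∑ 𝔲 ∈ idealsLE K x, sieveW 𝔴 c 𝔲 / ((Ideal.absNorm 𝔲 : ℕ) : ℝ) -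
          dedekindZeta_residue K *
            (∑ 𝔢 ∈ idealDivisors K 𝔴, (idealMoebius 𝔢 : ℝ) / Ideal.absNorm 𝔢) * Real.log x| ≤
        Real.exp ((1 + 2 * C₀) * Z) *
          ((∑ 𝔢 ∈ idealDivisors K 𝔴,
              (C + dedekindZeta_residue K * Real.log (Ideal.absNorm 𝔢)) / Ideal.absNorm 𝔢) +
            4 * dedekindZeta_residue K +
            dedekindZeta_residue K * D₀ ^ (-(1 : ℝ) / 4) * Real.log x))
    {𝔴 : Ideal (𝓞 K)} (h𝔴 : 𝔴 ≠ ⊥) (h2 : ∀ P : Ideal (𝓞 K), Prime P → Ideal.absNorm P = 2 → P ∣ 𝔴)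
    {D₀ : ℝ} (hD₀1 : 1 ≤ D₀)
    (hD : ∀ P : Ideal (𝓞 K), Prime P → (Ideal.absNorm P : ℝ) ≤ D₀ → P ∣ 𝔴)
    {R : ℝ} (hR1 : 1 < R) {M : ℕ} (hMpos : 0 < M) {G : (Fin (n + 1) → ℝ) → ℝ} (hG : Continuous G)
    (m : Fin (n + 1)) {ε₁ Gmax η₀ A Kc Z₃ τ : ℝ} (hε₁0 : 0 < ε₁) (hε₁1 : ε₁ ≤ 1) (hG0 : 0 ≤ Gmax)
    (hGmax : ∀ x ∈ maynardCube (n + 1), |G x| ≤ Gmax)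
    (hcont : ∀ t ∈ maynardCube (n + 1 + 1), ∀ t' ∈ maynardCube (n + 1 + 1),
      (∀ j, |t j - t' j| ≤ 1 / (M : ℝ)) → |gfun G m t - gfun G m t'| ≤ ε₁ / 16)
    (hint : IntegrableOn ((polytope (polyS (n + 1) m)).indicator (gfun G m)) (maynardCube (n + 1 + 1)) volume)
    (hq : 2 * Gmax ^ 2 * (∑ l, ((polyS (n + 1) m l).card + 1 : ℝ)) / M ≤ ε₁ / 32)
    (hη₀0 : 0 < η₀) (hη₀1 : η₀ ≤ 1)
    (hA : A = Gmax ^ 2 * ((n + 1 + 1 : ℕ) : ℝ) * 2 ^ (n + 1 + 1 - 1) + ((n + 1 + 1 : ℕ) : ℝ) * 2 ^ (n + 1 + 1 - 1) + 1)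
    (hη₀A : A * η₀ ≤ ε₁ / 8)
    (hKc : Kc = Real.exp ((1 + 2 * 4) * Z) * (max C (dedekindZeta_residue K) + 4 * dedekindZeta_residue K))
    (hε1 : Real.exp ((1 + 2 * 4) * Z) * (D₀ ^ (-(1 : ℝ) / 4) /
      ∑ 𝔢 ∈ idealDivisors K 𝔴, (idealMoebius 𝔢 : ℝ) / Ideal.absNorm 𝔢) ≤ η₀ / (4 * M))
    (hE2 : Kc / dedekindZeta_residue K *
      ((1 + ∑ 𝔢 ∈ idealDivisors K 𝔴, (1 + Real.log (Ideal.absNorm 𝔢)) / Ideal.absNorm 𝔢) /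
        ((∑ 𝔢 ∈ idealDivisors K 𝔴, (idealMoebius 𝔢 : ℝ) / Ideal.absNorm 𝔢) * Real.log R)) ≤
      η₀ / (4 * M))
    (hZ₃ : Z₃ = ∑' v : HeightOneSpectrum (𝓞 K), (Ideal.absNorm v.asIdeal : ℝ) ^ (-(3 : ℝ) / 2))
    (hτ0 : 0 ≤ τ) (hτ1 : τ ≤ 1) (hZτ : ∑ 𝔞 ∈ G1 K 𝔴 R, 1 / idealTotient K 𝔞 ^ 2 - 1 ≤ τ)
    (hbadA : ((6 * Gmax * (3 * (n + 1) * 2 ^ (n + 1) * Gmax) + (3 * (n + 1) * 2 ^ (n + 1) * Gmax) ^ 2) * 3 ^ n) *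
      τ ≤ ε₁ / 8)
    (hbadC : (Gmax ^ 2 * ((n : ℝ) + 2) ^ 2 * 3 ^ (n + 2) * 16 * Z₃) * D₀ ^ (-(1 : ℝ) / 2) ≤ ε₁ / 8) :
    |∑ 𝔲 ∈ boxG K (n + 1) 𝔴 R, ym K (n + 1) 𝔴 R (smoothY K (n + 1) G R 𝔴) m 𝔲 ^ 2 / ∏ i, gId K (𝔲 i) -
        (dedekindZeta_residue K *
            (∑ 𝔢 ∈ idealDivisors K 𝔴, (idealMoebius 𝔢 : ℝ) / Ideal.absNorm 𝔢) * Real.log R) ^ (n + 1 + 1) *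
          maynardJ (n + 1) m ((maynardSimplex (n + 1)).indicator G)| ≤
      3 / 4 * ε₁ * (dedekindZeta_residue K *
        (∑ 𝔢 ∈ idealDivisors K 𝔴, (idealMoebius 𝔢 : ℝ) / Ideal.absNorm 𝔢) * Real.log R) ^ (n + 1 + 1) := by
  classical
  have hρ0 : 0 < dedekindZeta_residue K := dedekindZeta_residue_pos K
  have hM0 : (0 : ℝ) < M := by exact_mod_cast hMpos
  have hM1' : (1 : ℝ) ≤ M := by exact_mod_cast hMpos
  have hηM1 : η₀ / (4 * M) ≤ 1 := by
    rw [div_le_one (by positivity)]; nlinarith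
  have hlogR0 : 0 < Real.log R := Real.log_pos hR1
  -- Steps D + E
  have hcoreD := S2sum_core_D hC0 hsharp h𝔴 hD₀1 hD hR1 hMpos hG m hε₁0 hε₁1 hG0 hGmax hcont hint hq hη₀0 hη₀1
    hA hη₀A hKc hε1 hE2
  -- the `L`-bounds
  have hLφ := sum_idealsLE_sieveW_div_le_three_mul hC0 hsharp h𝔴 hD₀1 hD hR1 (by norm_num : (0 : ℝ) ≤ 4)
    (fun P hP => abs_cPhi_le hP) hηM1 hKc hε1 hE2
  have hL3 := sum_idealsLE_sieveW_div_le_three_mul hC0 hsharp h𝔴 hD₀1 hD hR1 (by norm_num : (0 : ℝ) ≤ 4)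
    (fun P hP => abs_cW3_le hP) hηM1 hKc hε1 hE2
  have hLj := fun j => sum_G1_wtj_le_three_mul hC0 hsharp h𝔴 hD₀1 hD hR1 hηM1 hKc hε1 hE2 m j
  rw [← (sum_G1_inv_idealTotient_eq_sieveW 𝔴 R).1] at hLφ
  rw [← (sum_G1_inv_idealTotient_eq_sieveW 𝔴 R).2] at hL3
  -- `d`, `P`
  obtain ⟨dN, hdNdef⟩ : ∃ x : ℝ, x = ∑ 𝔢 ∈ idealDivisors K 𝔴,
      (idealMoebius 𝔢 : ℝ) / Ideal.absNorm 𝔢 := ⟨_, rfl⟩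
  have hdN0 : 0 < dN := by
    rw [hdNdef, dsum_eq_prod_one_sub_inv h𝔴]
    refine Finset.prod_pos fun P hP => ?_
    have h22 : (2 : ℝ) ≤ Ideal.absNorm P := by
      exact_mod_cast two_le_absNorm_of_prime (prime_of_normalized_factor P (Multiset.mem_toFinset.1 hP))
    have : 1 / (Ideal.absNorm P : ℝ) ≤ 1 / 2 := one_div_le_one_div_of_le (by norm_num) h22
    linarith
  rw [← hdNdef] at hcoreD hLφ hL3 hLj ⊢
  obtain ⟨P, hP⟩ : ∃ x : ℝ, x = dedekindZeta_residue K * dN * Real.log R := ⟨_, rfl⟩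
  have hP0 : 0 < P := by rw [hP]; positivity
  have hPeq : dedekindZeta_residue K * dN * Real.log R = P := hP.symm
  rw [hPeq] at hcoreD hLφ hL3 hLj ⊢
  obtain ⟨L, hLdef⟩ : ∃ x : ℝ, x = ∑ 𝔞 ∈ G1 K 𝔴 R, 1 / idealTotient K 𝔞 := ⟨_, rfl⟩
  obtain ⟨L₃, hL₃def⟩ : ∃ x : ℝ, x = ∑ 𝔞 ∈ G1 K 𝔴 R, w3 K 𝔞 := ⟨_, rfl⟩
  obtain ⟨Zs, hZsdef⟩ : ∃ x : ℝ, x = ∑ 𝔞 ∈ G1 K 𝔴 R, 1 / idealTotient K 𝔞 ^ 2 := ⟨_, rfl⟩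
  rw [← hLdef] at hLφ
  rw [← hL₃def] at hL3
  rw [← hZsdef] at hZτ
  have hpos : ∀ 𝔞 ∈ G1 K 𝔴 R, 0 < idealTotient K 𝔞 := fun 𝔞 ha => idealTotient_pos_of_mem_G1 ha
  have hL0 : 0 ≤ L := by rw [hLdef]; exact Finset.sum_nonneg fun 𝔞 ha => (one_div_pos.2 (hpos 𝔞 ha)).le
  have hL₃0 : 0 ≤ L₃ := by rw [hL₃def]; exact Finset.sum_nonneg fun 𝔞 ha => w3_nonneg_of_mem_G1 h2 ha
  have hZ1 : 1 ≤ Zs := by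
    have := Finset.single_le_sum (f := fun 𝔞 : Ideal (𝓞 K) => 1 / idealTotient K 𝔞 ^ 2)
      (fun 𝔞 ha => by have := hpos 𝔞 ha; positivity) (top_mem_G1 hR1.le)
    rw [idealTotient_top, one_pow, div_one] at this
    rw [hZsdef]; exact this
  -- Step A
  have hGmaxS : ∀ x ∈ maynardSimplex (n + 1), |G x| ≤ Gmax := fun x hx =>
    hGmax x (maynardSimplex_subset_maynardCube _ hx)
  have hAstep := abs_sum_ym_sq_div_sub_le h2 hR1.le (supportedOn_smoothY (n + 1) G R 𝔴)
    (abs_smoothY_le hGmaxS hG0 R 𝔴) (m := m)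
  rw [← hLdef, ← hL₃def, ← hZsdef, Nat.add_sub_cancel] at hAstep
  have hAbd := termA_le (n := n) hG0 hL0 hLφ hL₃0 hL3 hZ1 hZτ hτ0 hτ1 hP0.le
  have hA8 : ((6 * Gmax * (3 * (n + 1) * 2 ^ (n + 1) * Gmax) + (3 * (n + 1) * 2 ^ (n + 1) * Gmax) ^ 2) * 3 ^ n) *
      τ * P ^ (n + 2) ≤ ε₁ / 8 * P ^ (n + 2) := mul_le_mul_of_nonneg_right hbadA (pow_pos hP0 _).le
  -- Step B
  have hB := sum_filter_slot_Mterm_sq_eq hR1.le (supportedOn_smoothY (n + 1) G R 𝔴) (m := m)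
  -- Step C
  have hF : ∀ x, |(maynardSimplex (n + 1)).indicator G x| ≤ Gmax := fun x =>
    MaynardSieve.abs_indicator_simplex_le hG0 hGmax x
  have hCstep := abs_sum_weightH_sub_le h2 G hF (B := R) (m := m)
  have hQ : ((reqPairs (n + 1) m).card : ℝ) ≤ ((n : ℝ) + 2) ^ 2 := by
    have h1 : (reqPairs (n + 1) m).card ≤ (n + 2) * (n + 2) := by
      calc (reqPairs (n + 1) m).card ≤ (Finset.univ : Finset (Fin (n + 1 + 1) × Fin (n + 1 + 1))).card :=
            Finset.card_filter_le _ _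
        _ = (n + 2) * (n + 2) := by rw [Finset.card_univ, Fintype.card_prod, Fintype.card_fin]
    calc ((reqPairs (n + 1) m).card : ℝ) ≤ ((n + 2) * (n + 2) : ℕ) := by exact_mod_cast h1
      _ = ((n : ℝ) + 2) ^ 2 := by push_cast; ring
  have hLj0 : ∀ j, 0 ≤ ∑ 𝔞 ∈ G1 K 𝔴 R, wtj (K := K) m j 𝔞 := by
    intro j
    refine Finset.sum_nonneg fun 𝔞 ha => ?_
    rw [wtj]
    split_ifs
    · exact (one_div_pos.2 (hpos 𝔞 ha)).le
    · exact w3_nonneg_of_mem_G1 h2 ha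
  have hPi0 : 0 ≤ ∏ j, ∑ 𝔞 ∈ G1 K 𝔴 R, wtj (K := K) m j 𝔞 := Finset.prod_nonneg fun j _ => hLj0 j
  have hPi : ∏ j, ∑ 𝔞 ∈ G1 K 𝔴 R, wtj (K := K) m j 𝔞 ≤ (3 * P) ^ (n + 2) := by
    calc ∏ j, ∑ 𝔞 ∈ G1 K 𝔴 R, wtj (K := K) m j 𝔞 ≤ ∏ _j : Fin (n + 1 + 1), (3 * P) :=
          Finset.prod_le_prod (fun j _ => hLj0 j) fun j _ => hLj j
      _ = (3 * P) ^ (n + 2) := by rw [Finset.prod_const, Finset.card_univ, Fintype.card_fin]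
  have hS0 : 0 ≤ ∑ P ∈ ((finite_primeIdealsLE K R).toFinset).filter (fun P => ¬ P ∣ 𝔴),
      4 / (Ideal.absNorm P : ℝ) ^ 2 := Finset.sum_nonneg fun _ _ => by positivity
  have hS := sum_primes_four_div_sq_le hD₀1 hD R (K := K)
  rw [← hZ₃] at hS
  have hCbd := termC_le (n := n) (Gm := Gmax) hQ hPi0 hPi hS0 hS hP0.le
  have hC8 : (Gmax ^ 2 * ((n : ℝ) + 2) ^ 2 * 3 ^ (n + 2) * 16 * Z₃) * D₀ ^ (-(1 : ℝ) / 2) * P ^ (n + 2) ≤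
      ε₁ / 8 * P ^ (n + 2) := mul_le_mul_of_nonneg_right hbadC (pow_pos hP0 _).le
  -- combine
  rw [hB] at hAstep
  have htri := abs_sub_le
    (∑ 𝔲 ∈ boxG K (n + 1) 𝔴 R, ym K (n + 1) 𝔴 R (smoothY K (n + 1) G R 𝔴) m 𝔲 ^ 2 / ∏ i, gId K (𝔲 i))
    (∑ z ∈ Fintype.piFinset (fun _ : Fin (n + 1 + 1) => G1 K 𝔴 R),
        (∏ i ∈ Finset.univ.erase m, w3 K (z (Fin.castSucc i))) *
          ((smoothY K (n + 1) G R 𝔴 (zcs z) / idealTotient K (z (Fin.castSucc m))) *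
            (smoothY K (n + 1) G R 𝔴 (zup m z) / idealTotient K (z (Fin.last (n + 1))))))
    (P ^ (n + 1 + 1) * maynardJ (n + 1) m ((maynardSimplex (n + 1)).indicator G))
  have htri2 := abs_sub_le
    (∑ z ∈ Fintype.piFinset (fun _ : Fin (n + 1 + 1) => G1 K 𝔴 R),
        (∏ i ∈ Finset.univ.erase m, w3 K (z (Fin.castSucc i))) *
          ((smoothY K (n + 1) G R 𝔴 (zcs z) / idealTotient K (z (Fin.castSucc m))) *
            (smoothY K (n + 1) G R 𝔴 (zup m z) / idealTotient K (z (Fin.last (n + 1))))))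
    (∑ z ∈ Fintype.piFinset (fun _ : Fin (n + 1 + 1) => G1 K 𝔴 R),
        (∏ j, wtj m j (z j)) * ((maynardSimplex (n + 1)).indicator G (xOf R (zcs z)) *
          (maynardSimplex (n + 1)).indicator G (xOf R (zup m z))))
    (P ^ (n + 1 + 1) * maynardJ (n + 1) m ((maynardSimplex (n + 1)).indicator G))
  rw [abs_sub_comm] at hCstep
  have hsum : ε₁ / 8 * P ^ (n + 2) + (ε₁ / 8 * P ^ (n + 2) + P ^ (n + 1 + 1) * (ε₁ / 2)) =
      3 / 4 * ε₁ * P ^ (n + 1 + 1) := by ring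
  rw [← hsum]
  exact htri.trans (add_le_add (hAstep.trans (hAbd.trans hA8))
    (htri2.trans (add_le_add (hCstep.trans (hCbd.trans hC8)) hcoreD)))

end Core

/-! ### The `o(1)` statement along parameters -/

/-- `g` is continuous. [folklore] -/
theorem continuous_gfun {n : ℕ} {G : (Fin (n + 1) → ℝ) → ℝ} (hG : Continuous G) (m : Fin (n + 1)) :
    Continuous (gfun G m) := by
  have hcs : Continuous fun ξ : Fin (n + 1 + 1) → ℝ => fun i : Fin (n + 1) => ξ (Fin.castSucc i) :=
    continuous_pi fun i => continuous_apply _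
  unfold gfun
  exact (hG.comp hcs).mul (hG.comp (hcs.update m (continuous_apply _)))

/-- **The main term of `S₂^{(m)}` over `𝓞_K`, `o`-form** (Castillo et al., proof of
Proposition 2.1 = Maynard's Lemma 6.3 over `𝓞_K`): along parameters `𝔴(N) ≠ 0` (the primes of norm
`2` dividing `𝔴(N)` eventually), `D₀(N) → ∞` with every prime of norm `≤ D₀(N)` dividing `𝔴(N)`,
`R(N) → ∞`, such that `D₀^{-1/4}/d → 0` and `(1 + ∑_{𝔢∣𝔴}(1+log N𝔢)/N𝔢)/(d log R) → 0`, for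
continuous `G`, `F = 1_{R_k} G` and the smooth coefficients `y = F(log N𝔯ᵢ/log R)`:
`∑_{𝔲 good} (y^{(m)}_𝔲)²/∏ g(𝔲ᵢ) − (c_K d log R)^{k+1} J_k^{(m)}(F) = o((c_K d log R)^{k+1})`.
[cite: CastilloEtAl2015, proof of Proposition 2.1; MaynardAnnals2015, Lemmas 5.3, 6.3] -/
theorem S2sum_isLittleO {n : ℕ} {G : (Fin (n + 1) → ℝ) → ℝ} (hG : Continuous G) (m : Fin (n + 1))
    {𝔴 : ℝ → Ideal (𝓞 K)} {D₀ R : ℝ → ℝ}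
    (h𝔴 : ∀ N, 𝔴 N ≠ ⊥) (h2 : ∀ᶠ N in atTop, ∀ P : Ideal (𝓞 K), Prime P → Ideal.absNorm P = 2 → P ∣ 𝔴 N)
    (hD₀ : Tendsto D₀ atTop atTop)
    (hD : ∀ N, ∀ P : Ideal (𝓞 K), Prime P → (Ideal.absNorm P : ℝ) ≤ D₀ N → P ∣ 𝔴 N)
    (hR : Tendsto R atTop atTop)
    (hε : Tendsto (fun N => D₀ N ^ (-(1 : ℝ) / 4) /
        ∑ 𝔢 ∈ idealDivisors K (𝔴 N), (idealMoebius 𝔢 : ℝ) / Ideal.absNorm 𝔢) atTop (𝓝 0))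
    (hE : Tendsto (fun N =>
        (1 + ∑ 𝔢 ∈ idealDivisors K (𝔴 N), (1 + Real.log (Ideal.absNorm 𝔢)) / Ideal.absNorm 𝔢) /
          ((∑ 𝔢 ∈ idealDivisors K (𝔴 N), (idealMoebius 𝔢 : ℝ) / Ideal.absNorm 𝔢) *
            Real.log (R N))) atTop (𝓝 0)) :
    (fun N => ∑ 𝔲 ∈ boxG K (n + 1) (𝔴 N) (R N),
        ym K (n + 1) (𝔴 N) (R N) (smoothY K (n + 1) G (R N) (𝔴 N)) m 𝔲 ^ 2 / ∏ i, gId K (𝔲 i) -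
        (dedekindZeta_residue K *
            (∑ 𝔢 ∈ idealDivisors K (𝔴 N), (idealMoebius 𝔢 : ℝ) / Ideal.absNorm 𝔢) *
              Real.log (R N)) ^ (n + 1 + 1) * maynardJ (n + 1) m ((maynardSimplex (n + 1)).indicator G)) =o[atTop]
      fun N => (dedekindZeta_residue K *
        (∑ 𝔢 ∈ idealDivisors K (𝔴 N), (idealMoebius 𝔢 : ℝ) / Ideal.absNorm 𝔢) * Real.log (R N)) ^ (n + 1 + 1) := by
  classical
  have hcubeK : IsCompact (maynardCube (n + 1)) := isCompact_univ_pi fun _ => isCompact_Icc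
  have hcubeK2 : IsCompact (maynardCube (n + 1 + 1)) := isCompact_univ_pi fun _ => isCompact_Icc
  obtain ⟨Gmax, hG0, hGmax⟩ : ∃ M : ℝ, 0 ≤ M ∧ ∀ x ∈ maynardCube (n + 1), |G x| ≤ M := by
    obtain ⟨M, hM⟩ := hcubeK.exists_bound_of_continuousOn hG.continuousOn
    exact ⟨max M 0, le_max_right _ _, fun x hx =>
      (Real.norm_eq_abs (G x) ▸ hM x hx).trans (le_max_left _ _)⟩
  have hgc : Continuous (gfun G m) := continuous_gfun hG m
  have hint : IntegrableOn ((polytope (polyS (n + 1) m)).indicator (gfun G m)) (maynardCube (n + 1 + 1)) volume :=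
    (hgc.continuousOn.integrableOn_compact hcubeK2).indicator (measurableSet_polytope' _)
  obtain ⟨L', hL'⟩ : ∃ x : ℝ, x = ∑ l, ((polyS (n + 1) m l).card + 1 : ℝ) := ⟨_, rfl⟩
  have hL'0 : 0 ≤ L' := by rw [hL']; exact Finset.sum_nonneg fun l _ => by positivity
  -- uniform continuity of `G` on the cube
  have huc : UniformContinuousOn G (maynardCube (n + 1)) := hcubeK.uniformContinuousOn_of_continuous hG.continuousOn
  -- constants
  obtain ⟨C, Z, hC0, hZ0, hsharp⟩ := abs_sum_sieveW_div_sub_sharp (K := K)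
  have hρ0 : 0 < dedekindZeta_residue K := dedekindZeta_residue_pos K
  obtain ⟨Z₃, hZ₃⟩ : ∃ x : ℝ, x = ∑' v : HeightOneSpectrum (𝓞 K),
      (Ideal.absNorm v.asIdeal : ℝ) ^ (-(3 : ℝ) / 2) := ⟨_, rfl⟩
  obtain ⟨Kc, hKc⟩ : ∃ x : ℝ, x = Real.exp ((1 + 2 * 4) * Z) *
      (max C (dedekindZeta_residue K) + 4 * dedekindZeta_residue K) := ⟨_, rfl⟩
  obtain ⟨Zc, hZc0, hZc⟩ := sum_inv_prod_sub_sq_le (K := K)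
  obtain ⟨KA, hKA⟩ : ∃ x : ℝ, x = (6 * Gmax * (3 * (n + 1) * 2 ^ (n + 1) * Gmax) +
      (3 * (n + 1) * 2 ^ (n + 1) * Gmax) ^ 2) * 3 ^ n := ⟨_, rfl⟩
  have hKA0 : 0 ≤ KA := by rw [hKA]; positivity
  obtain ⟨KC, hKC⟩ : ∃ x : ℝ, x = Gmax ^ 2 * ((n : ℝ) + 2) ^ 2 * 3 ^ (n + 2) * 16 * Z₃ := ⟨_, rfl⟩
  have hZ₃0 : 0 ≤ Z₃ := by rw [hZ₃]; exact tsum_nonneg fun v => by positivity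
  have hKC0 : 0 ≤ KC := by rw [hKC]; positivity
  -- the target
  rw [Asymptotics.isLittleO_iff]
  intro ε₀ hε₀
  obtain ⟨ε₁, hε₁⟩ : ∃ e : ℝ, e = min ε₀ 1 := ⟨_, rfl⟩
  have hε₁0 : 0 < ε₁ := by rw [hε₁]; exact lt_min hε₀ one_pos
  have hε₁1 : ε₁ ≤ 1 := by rw [hε₁]; exact min_le_right _ _
  have hε₁ε : ε₁ ≤ ε₀ := by rw [hε₁]; exact min_le_left _ _
  -- the mesh `M` from the modulus of continuity of `G`
  obtain ⟨δ₁, hδ₁, hδ⟩ := Metric.uniformContinuousOn_iff.1 huc (ε₁ / (32 * (Gmax + 1))) (by positivity)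
  obtain ⟨M, hM1, hM2⟩ : ∃ M : ℕ, 1 / δ₁ < M ∧ 64 * Gmax ^ 2 * L' / ε₁ ≤ M := by
    refine ⟨⌈max (1 / δ₁) (64 * Gmax ^ 2 * L' / ε₁)⌉₊ + 1, ?_, ?_⟩
    · calc 1 / δ₁ ≤ max (1 / δ₁) (64 * Gmax ^ 2 * L' / ε₁) := le_max_left _ _
        _ ≤ ⌈max (1 / δ₁) (64 * Gmax ^ 2 * L' / ε₁)⌉₊ := Nat.le_ceil _
        _ < _ := by push_cast; linarith
    · calc 64 * Gmax ^ 2 * L' / ε₁ ≤ max (1 / δ₁) (64 * Gmax ^ 2 * L' / ε₁) := le_max_right _ _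
        _ ≤ ⌈max (1 / δ₁) (64 * Gmax ^ 2 * L' / ε₁)⌉₊ := Nat.le_ceil _
        _ ≤ _ := by push_cast; linarith
  have hM0 : (0 : ℝ) < M := lt_of_le_of_lt (by positivity) hM1
  have hMpos : 0 < M := by exact_mod_cast hM0
  have hMδ : 1 / (M : ℝ) < δ₁ := by
    rw [div_lt_iff₀ hM0]
    calc (1 : ℝ) = δ₁ * (1 / δ₁) := by field_simp
      _ < δ₁ * M := by gcongr
  have hcont : ∀ t ∈ maynardCube (n + 1 + 1), ∀ t' ∈ maynardCube (n + 1 + 1),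
      (∀ j, |t j - t' j| ≤ 1 / (M : ℝ)) → |gfun G m t - gfun G m t'| ≤ ε₁ / 16 := by
    intro t ht t' ht' hd
    have htc := Set.mem_univ_pi.1 ht
    have htc' := Set.mem_univ_pi.1 ht'
    -- the two arguments of `G`
    have ha : (fun i => t (Fin.castSucc i)) ∈ maynardCube (n + 1) := Set.mem_univ_pi.2 fun i => htc _
    have ha' : (fun i => t' (Fin.castSucc i)) ∈ maynardCube (n + 1) := Set.mem_univ_pi.2 fun i => htc' _
    have hb : Function.update (fun i => t (Fin.castSucc i)) m (t (Fin.last (n + 1))) ∈ maynardCube (n + 1) := by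
      refine Set.mem_univ_pi.2 fun i => ?_
      by_cases hi : i = m
      · rw [hi, Function.update_self]; exact htc _
      · rw [Function.update_of_ne hi]; exact htc _
    have hb' : Function.update (fun i => t' (Fin.castSucc i)) m (t' (Fin.last (n + 1))) ∈ maynardCube (n + 1) := by
      refine Set.mem_univ_pi.2 fun i => ?_
      by_cases hi : i = m
      · rw [hi, Function.update_self]; exact htc' _
      · rw [Function.update_of_ne hi]; exact htc' _
    have hdista : dist (fun i => t (Fin.castSucc i)) (fun i => t' (Fin.castSucc i)) < δ₁ := by
      refine lt_of_le_of_lt ((dist_pi_le_iff (by positivity)).2 fun i => ?_) hMδ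
      rw [Real.dist_eq]; exact hd _
    have hdistb : dist (Function.update (fun i => t (Fin.castSucc i)) m (t (Fin.last (n + 1))))
        (Function.update (fun i => t' (Fin.castSucc i)) m (t' (Fin.last (n + 1)))) < δ₁ := by
      refine lt_of_le_of_lt ((dist_pi_le_iff (by positivity)).2 fun i => ?_) hMδ
      rw [Real.dist_eq]
      by_cases hi : i = m
      · rw [hi, Function.update_self, Function.update_self]; exact hd _
      · rw [Function.update_of_ne hi, Function.update_of_ne hi]; exact hd _
    have h1 := hδ _ ha _ ha' hdista
    have h2' := hδ _ hb _ hb' hdistb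
    rw [Real.dist_eq] at h1 h2'
    rw [gfun, gfun]
    have key : ∀ (a b a' b' : ℝ), |a| ≤ Gmax → |b'| ≤ Gmax → |a - a'| ≤ ε₁ / (32 * (Gmax + 1)) →
        |b - b'| ≤ ε₁ / (32 * (Gmax + 1)) → |a * b - a' * b'| ≤ ε₁ / 16 := by
      intro a b a' b' ha0 hb0 hda hdb
      have e : a * b - a' * b' = a * (b - b') + (a - a') * b' := by ring
      rw [e]
      calc |a * (b - b') + (a - a') * b'| ≤ |a * (b - b')| + |(a - a') * b'| := abs_add_le _ _
        _ = |a| * |b - b'| + |a - a'| * |b'| := by rw [abs_mul, abs_mul]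
        _ ≤ Gmax * (ε₁ / (32 * (Gmax + 1))) + (ε₁ / (32 * (Gmax + 1))) * Gmax :=
            add_le_add (mul_le_mul ha0 hdb (abs_nonneg _) hG0) (mul_le_mul hda hb0 (abs_nonneg _) (by positivity))
        _ = ε₁ / 16 * (Gmax / (Gmax + 1)) := by field_simp; ring
        _ ≤ ε₁ / 16 * 1 := by
            refine mul_le_mul_of_nonneg_left ?_ (by positivity)
            rw [div_le_one (by positivity)]; linarith
        _ = ε₁ / 16 := mul_one _
    exact key _ _ _ _ (hGmax _ ha) (hGmax _ hb') h1.le h2'.le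
  have hq : 2 * Gmax ^ 2 * (∑ l, ((polyS (n + 1) m l).card + 1 : ℝ)) / M ≤ ε₁ / 32 := by
    rw [← hL', div_le_iff₀ hM0]
    have := (div_le_iff₀ hε₁0).1 hM2
    linarith
  -- `η₀`
  obtain ⟨A, hA⟩ : ∃ x : ℝ, x = Gmax ^ 2 * ((n + 1 + 1 : ℕ) : ℝ) * 2 ^ (n + 1 + 1 - 1) +
      ((n + 1 + 1 : ℕ) : ℝ) * 2 ^ (n + 1 + 1 - 1) + 1 := ⟨_, rfl⟩
  have hA0 : 0 < A := by rw [hA]; positivity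
  obtain ⟨η₀, hη₀⟩ : ∃ e : ℝ, e = min 1 (ε₁ / (8 * A)) := ⟨_, rfl⟩
  have hη₀0 : 0 < η₀ := by rw [hη₀]; exact lt_min one_pos (by positivity)
  have hη₀1 : η₀ ≤ 1 := by rw [hη₀]; exact min_le_left _ _
  have hη₀A : A * η₀ ≤ ε₁ / 8 := by
    have : η₀ ≤ ε₁ / (8 * A) := by rw [hη₀]; exact min_le_right _ _
    rw [le_div_iff₀ (by positivity)] at this
    linarith
  have hηM : 0 < η₀ / (4 * M) := by positivity
  -- eventual smallness
  have hev1 : ∀ᶠ N in atTop, Real.exp ((1 + 2 * 4) * Z) * (D₀ N ^ (-(1 : ℝ) / 4) /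
      ∑ 𝔢 ∈ idealDivisors K (𝔴 N), (idealMoebius 𝔢 : ℝ) / Ideal.absNorm 𝔢) ≤ η₀ / (4 * M) := by
    have h1 := hε.const_mul (Real.exp ((1 + 2 * 4) * Z))
    rw [mul_zero] at h1
    exact h1.eventually (eventually_le_nhds hηM)
  have hev2 : ∀ᶠ N in atTop, Kc / dedekindZeta_residue K *
      ((1 + ∑ 𝔢 ∈ idealDivisors K (𝔴 N), (1 + Real.log (Ideal.absNorm 𝔢)) / Ideal.absNorm 𝔢) /
        ((∑ 𝔢 ∈ idealDivisors K (𝔴 N), (idealMoebius 𝔢 : ℝ) / Ideal.absNorm 𝔢) * Real.log (R N))) ≤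
      η₀ / (4 * M) := by
    have h1 := hE.const_mul (Kc / dedekindZeta_residue K)
    rw [mul_zero] at h1
    exact h1.eventually (eventually_le_nhds hηM)
  have hD12 : Tendsto (fun N => D₀ N ^ (-(1 : ℝ) / 2)) atTop (𝓝 0) := by
    have h1 : Tendsto (fun N => D₀ N ^ (-(1 / 2 : ℝ))) atTop (𝓝 0) :=
      (tendsto_rpow_neg_atTop (by norm_num : (0 : ℝ) < 1 / 2)).comp hD₀
    refine h1.congr' (Eventually.of_forall fun N => ?_)
    norm_num
  have hevC : ∀ᶠ N in atTop, KC * D₀ N ^ (-(1 : ℝ) / 2) ≤ ε₁ / 8 := by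
    have h1 := hD12.const_mul KC
    rw [mul_zero] at h1
    exact h1.eventually (eventually_le_nhds (by positivity))
  have hevA : ∀ᶠ N in atTop, KA * (4 * Zc * Real.exp (4 * Zc) * D₀ N ^ (-(1 : ℝ) / 2)) ≤ ε₁ / 8 ∧
      4 * Zc * Real.exp (4 * Zc) * D₀ N ^ (-(1 : ℝ) / 2) ≤ 1 := by
    have h1 := hD12.const_mul (KA * (4 * Zc * Real.exp (4 * Zc)))
    have h2' := hD12.const_mul (4 * Zc * Real.exp (4 * Zc))
    rw [mul_zero] at h1 h2'
    filter_upwards [h1.eventually (eventually_le_nhds (by positivity : (0 : ℝ) < ε₁ / 8)),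
      h2'.eventually (eventually_le_nhds one_pos)] with N ha hb
    refine ⟨?_, hb⟩
    calc KA * (4 * Zc * Real.exp (4 * Zc) * D₀ N ^ (-(1 : ℝ) / 2))
        = KA * (4 * Zc * Real.exp (4 * Zc)) * D₀ N ^ (-(1 : ℝ) / 2) := by ring
      _ ≤ ε₁ / 8 := ha
  filter_upwards [hev1, hev2, hevC, hevA, h2, hD₀.eventually_ge_atTop 1, hR.eventually_ge_atTop 2]
    with N hε1 hE2 hbadC hbadA h2N hD₀1 hR2
  have hR1 : 1 < R N := by linarith
  -- the junk factor `τ`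
  obtain ⟨τ, hτ⟩ : ∃ x : ℝ, x = 4 * Zc * Real.exp (4 * Zc) * D₀ N ^ (-(1 : ℝ) / 2) := ⟨_, rfl⟩
  rw [← hτ] at hbadA
  have hτ0 : 0 ≤ τ := by rw [hτ]; positivity
  have hZτ : ∑ 𝔞 ∈ G1 K (𝔴 N) (R N), 1 / idealTotient K 𝔞 ^ 2 - 1 ≤ τ := by
    rw [sum_G1_inv_idealTotient_sq_sub_one_eq (𝔴 N) hR1.le, hτ]
    refine (hZc 1 (𝔴 N) (h𝔴 N) (D₀ N) hD₀1 (by exact_mod_cast hD₀1) (hD N) (R N)).trans (le_of_eq ?_)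
    norm_num
  have hcore := S2sum_core hC0 hsharp (h𝔴 N) h2N hD₀1 (hD N) hR1 hMpos hG m hε₁0 hε₁1 hG0 hGmax hcont hint
    hq hη₀0 hη₀1 hA hη₀A hKc hε1 hE2 hZ₃ hτ0 hbadA.2 hZτ (by rw [← hKA]; exact hbadA.1) (by rw [← hKC]; exact hbadC)
  -- positivity of the scale
  have hd0 : 0 < ∑ 𝔢 ∈ idealDivisors K (𝔴 N), (idealMoebius 𝔢 : ℝ) / Ideal.absNorm 𝔢 := by
    rw [dsum_eq_prod_one_sub_inv (h𝔴 N)]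
    refine Finset.prod_pos fun P hP => ?_
    have h22 : (2 : ℝ) ≤ Ideal.absNorm P := by
      exact_mod_cast two_le_absNorm_of_prime (prime_of_normalized_factor P (Multiset.mem_toFinset.1 hP))
    have : 1 / (Ideal.absNorm P : ℝ) ≤ 1 / 2 := one_div_le_one_div_of_le (by norm_num) h22
    linarith
  have hP0 : 0 < dedekindZeta_residue K *
      (∑ 𝔢 ∈ idealDivisors K (𝔴 N), (idealMoebius 𝔢 : ℝ) / Ideal.absNorm 𝔢) * Real.log (R N) :=
    mul_pos (mul_pos hρ0 hd0) (Real.log_pos hR1)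
  rw [Real.norm_eq_abs, Real.norm_eq_abs, abs_of_pos (pow_pos hP0 _)]
  refine hcore.trans (mul_le_mul_of_nonneg_right ?_ (pow_pos hP0 _).le)
  linarith


end Literature.NumberTheory.Sieve.MaynardNF
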